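import Mathlib.FieldTheory.Finite.Basic
import Mathlib.Data.Nat.Choose.Lucas
import Mathlib.RingTheory.PrincipalIdealDomain
import Mathlib.Data.Fintype.BigOperators
import Mathlib.Algebra.Order.BigOperators.Group.Finset
import Mathlib.Algebra.BigOperators.Ring.Finset
import Mathlib.Data.Fintype.Pi
import Mathlib.Data.Nat.Factorization.Basic
import Literature.Computability.Complexity.CircuitSemantics
import Literature.Computability.Complexity.CircuitRestriction
import Literature.Computability.Complexity.SymPlus
import Literature.Computability.Complexity.Williams2014
import HarnessLib

/-!
# `ACC⁰ ⊆ SYM⁺`: proof of the representation theorem (Beigel–Tarui 1994, Thm. 1.1)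

Literature / circuit complexity (serves `Literature.Computability.Complexity.williams_acc` through `SymPlus.lean` and
`Williams2014.lean`). This file discharges the named fact `Williams2014_symPlus_of_acc` of
`Literature/Computability/Complexity/SymPlus.lean`:

* `Williams2014_symPlus_of_acc_holds` — for every depth `d` and modulus `m ≥ 2` there is an
  exponent `e` such that every circuit over `accBasis m` of `acDepth ≤ d` on `n ≤ s` inputs with
  at most `s` gates of fan-in at most `s` has an equivalent `SYM⁺` circuit with at most
  `2 ^ ((log₂ s + 2) ^ e)` AND-terms, each of fan-in at most `(log₂ s + 2) ^ e`.

## The proof (Beigel–Tarui 1994, §2, non-uniform version)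

All polynomials are integer straight-line formulas (`AForm`) with syntactic degree `deg` and
weight `wt` (a bound for the norm, Beigel–Tarui §1.3/§2.4); on `{0,1}`-points a formula is the
signed sum of at most `wt` multilinear monomials in at most `deg` variables each
(`AForm.eval_eq_expand`, `AForm.length_expand_le_wt`, `AForm.card_le_deg_of_mem_expand`).

1. *Probabilistic OR/AND (Lemma 2.3, Remark 2.4, Lemma 2.5).* Every AND/OR gate of `C` is
   replaced by `T₀ = log₂ s + 5` parity tests on seed-selected subsets of its arguments
   (`BT.rop`, `BT.rand`); for each input a uniformly random seed errs at some gate with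
   probability `≤ s · 2^{-T₀} ≤ 1/16` (`BT.card_bad_le`, from the exact isolation count
   `Derand.two_mul_card_even_count_eq`), so by a union bound over the `≤ 2ⁿ` inputs
   (`Derand.exists_majority_good`, replacing the Chernoff bound of Remark 2.4) there are `n + 1`
   seeds such that on every input the majority of the `n + 1` randomized copies of `C` is correct
   (`BT.exists_seeds_majority`).
2. *Modular gate polynomials (Lemma 2.1, Fact 2.2, Lemma 2.5, Cases 1–2).* In the variables
   "input `i`", "gate `j` of copy `c`" and "auxiliary `MOD_{p^e}` value of gate `j` of copy `c`,
   `p ∣ m`" (`BT.V`, valuation `BT.Setup.val`), every admissible non-input variable `v` satisfies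
   `val v = [F_v ≢ 0 (mod p_v)]` for a polynomial `F_v` (`BT.Setup.FF`) of bounded degree in
   variables of smaller *level* (`BT.Setup.val_eq_indNZ`, `BT.Setup.varsIn_FF`,
   `BT.Setup.level`): modulo `2` for the randomized AND/OR gates and for the composite
   `MODₘ = ⋁_{p ∣ m} [p^{ν_p(m)} ∤ ·]` over the auxiliary variables (`BT.Setup.val_gate_eq`),
   and `[p^e ∤ N] ≡ 1 - ∏_{t<e} (1 - e_{p^t}(ℓ)^{p-1}) (mod p)` for the auxiliary variables, by
   Lucas' theorem and Fermat's little theorem (`BT.Setup.val_aux_eq`,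
   `BT.pow_dvd_iff_forall_dvd_choose`). Chains of negations are first resolved into literals
   (`BT.srcLit`, `BT.Setup.litF`), so that NOT gates cost no level.
3. *Collapse by modulus amplification (§1.4, §2.3, Fact 2.7, Lemma 2.8, §2.4).* Starting from
   the degree-one formula `Σ_c ℓ(output of copy c)` and the symmetric function "majority"
   (`BT.Setup.inv_init`), the levels are eliminated from the top (`BT.Setup.inv_step`): all
   variables of one level are defined modulo one prime `p` (`BT.Setup.stagePrime_level`);
   substituting the `κ`-fold Yao/Toda iterate of `N ↦ 3N² - 2N³` applied to `F_v^{p-1}` for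
   every variable `v` of the level preserves the value of the formula modulo `p^{2^κ}`
   (`AForm.eval_modEq_eval_collapse`), and since `p^{2^κ} > 2 · wt` the old value is decoded from
   the new one (`AForm.decode_eq`), the decoding being absorbed into the output function.
   Degree and `log₂`-weight stay `≤ λ^E` with `λ = log₂ s + 2` and `E ↦ 3E + (m³ + m + 12)`
   per stage (`BT.iterE`; there are `(m+1)·d` stages, `BT.Setup.inv_zero_of_inv`).
4. *Expansion (end of §2.4; Williams 2014, App. A, Transformation 4).* The final formula
   mentions inputs only; its expansion into monomials gives the AND-terms, a coefficient `a`
   becoming `a mod K` copies of its term (`K = 2·wt + 1`), and the symmetric gate decodes the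
   count modulo `K` (`BT.Setup.symPlus_of_inv`).

## Design notes

* Yao's amplifying polynomial `3N² - 2N³` iterated (degree `3^κ` for the modulus `p^{2^κ}`,
  Beigel–Tarui §2.3) is used instead of Beigel–Tarui's optimal `P_k`; this only affects `e`.
* The derandomization is exhaustive counting over the finite seed space `BT.Seed`; no
  probability theory is used. The seeds of the copies are data of `BT.Setup`.
* The symbolic gate codes `accCode` come from `Williams2014.lean`; circuits, `accBasis`,
  `acDepth`, `wdepths` from `Circuit.lean`/`ConstantDepth.lean`/`CircuitRestriction.lean`.
* The exponent is explicit but not optimized: `e = BT.iterE (m³+m+7) ((m+1)·d) 2 + 2`.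

## References

* R. Beigel, J. Tarui, *On ACC*, Comput. Complexity 4 (1994) 350–366: Thm. 1.1, §1.4,
  Lemma 2.1, Fact 2.2, Lemma 2.3, Remark 2.4, Lemma 2.5, §2.3, Fact 2.7, Lemma 2.8, §2.4
  [BeigelTarui1994].
* R. Williams, *Nonuniform ACC circuit lower bounds*, J. ACM 61 (2014), Lemma 4.1 and
  Appendix A [Williams2014].
* A. C.-C. Yao, *On ACC and threshold circuits*, FOCS 1990; S. Toda, *PP is as hard as the
  polynomial-time hierarchy*, SIAM J. Comput. 20 (1991) (modulus amplification);
  A. A. Razborov (1987), R. Smolensky (1987) (probabilistic polynomials for OR).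
-/

namespace Literature.Computability.Complexity
/-- Integer arithmetic formulas (straight-line `+`/`×` expressions with integer constants) over
the variables `σ`: the syntax in which the polynomials of Beigel–Tarui's modular polynomial
circuits are manipulated (Beigel–Tarui 1994, §2: "All polynomials in the paper are over `ℤ`").
Degree and norm are tracked syntactically (`AForm.deg`, `AForm.wt`). [cite: BeigelTarui1994, §2] -/
inductive AForm (σ : Type*) : Type _
  | var : σ → AForm σ
  | cst : ℤ → AForm σ
  | add : AForm σ → AForm σ → AForm σ
  | mul : AForm σ → AForm σ → AForm σ

namespace AForm

variable {σ σ' : Type*}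

/-- Evaluation of a formula at an integer point. [folklore] -/
def eval (ν : σ → ℤ) : AForm σ → ℤ
  | var v => ν v
  | cst c => c
  | add F G => F.eval ν + G.eval ν
  | mul F G => F.eval ν * G.eval ν

/-- Syntactic degree: an upper bound for the total degree of the polynomial. [folklore] -/
def deg : AForm σ → ℕ
  | var _ => 1
  | cst _ => 0
  | add F G => max F.deg G.deg
  | mul F G => F.deg + G.deg

/-- Syntactic weight: bounds both the norm (sum of absolute values of the coefficients of the
expanded polynomial, hence `|F(x)|` on `{0,1}`-points, Beigel–Tarui 1994, §2.4) and the number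
of monomials of the expansion. [cite: BeigelTarui1994, §2.4] -/
def wt : AForm σ → ℕ
  | var _ => 1
  | cst c => max 1 c.natAbs
  | add F G => F.wt + G.wt
  | mul F G => F.wt * G.wt

/-- Weights are positive. [folklore] -/
theorem one_le_wt : ∀ F : AForm σ, 1 ≤ F.wt
  | var _ => le_rfl
  | cst _ => le_max_left _ _
  | add F _ => Nat.le_add_right_of_le (one_le_wt F)
  | mul F G => Nat.one_le_iff_ne_zero.2 (Nat.mul_ne_zero (Nat.one_le_iff_ne_zero.1 (one_le_wt F))
      (Nat.one_le_iff_ne_zero.1 (one_le_wt G)))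

/-- Substitution of formulas for variables. [folklore] -/
def subst (τ : σ → AForm σ') : AForm σ → AForm σ'
  | var v => τ v
  | cst c => cst c
  | add F G => add (F.subst τ) (G.subst τ)
  | mul F G => mul (F.subst τ) (G.subst τ)

/-- Evaluating a substitution instance = evaluating at the evaluated substitution. [folklore] -/
theorem eval_subst (τ : σ → AForm σ') (ν : σ' → ℤ) :
    ∀ F : AForm σ, (F.subst τ).eval ν = F.eval (fun v => (τ v).eval ν)
  | var _ => rfl
  | cst _ => rfl
  | add F G => by simp only [subst, eval, eval_subst τ ν F, eval_subst τ ν G]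
  | mul F G => by simp only [subst, eval, eval_subst τ ν F, eval_subst τ ν G]

/-- Degree of a substitution instance. [folklore] -/
theorem deg_subst_le {τ : σ → AForm σ'} {B : ℕ} (hτ : ∀ v, (τ v).deg ≤ B) :
    ∀ F : AForm σ, (F.subst τ).deg ≤ F.deg * B
  | var v => by simpa [subst, deg] using hτ v
  | cst _ => by simp [subst, deg]
  | add F G => by
    simp only [subst, deg]
    exact max_le ((deg_subst_le hτ F).trans (Nat.mul_le_mul_right _ (le_max_left _ _)))
      ((deg_subst_le hτ G).trans (Nat.mul_le_mul_right _ (le_max_right _ _)))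
  | mul F G => by
    simp only [subst, deg, Nat.add_mul]
    exact Nat.add_le_add (deg_subst_le hτ F) (deg_subst_le hτ G)

/-- Weight of a substitution instance. [folklore] -/
theorem wt_subst_le {τ : σ → AForm σ'} {B : ℕ} (hB : 1 ≤ B) (hτ : ∀ v, (τ v).wt ≤ B) :
    ∀ F : AForm σ, (F.subst τ).wt ≤ F.wt * B ^ F.deg
  | var v => by simpa [subst, deg, wt] using hτ v
  | cst _ => by simp [subst, deg, wt]
  | add F G => by
    simp only [subst, deg, wt, Nat.add_mul]
    refine Nat.add_le_add ((wt_subst_le hB hτ F).trans ?_) ((wt_subst_le hB hτ G).trans ?_)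
    · exact Nat.mul_le_mul_left _ (Nat.pow_le_pow_right hB (le_max_left _ _))
    · exact Nat.mul_le_mul_left _ (Nat.pow_le_pow_right hB (le_max_right _ _))
  | mul F G => by
    simp only [subst, deg, wt, Nat.pow_add]
    calc (F.subst τ).wt * (G.subst τ).wt ≤ (F.wt * B ^ F.deg) * (G.wt * B ^ G.deg) :=
          Nat.mul_le_mul (wt_subst_le hB hτ F) (wt_subst_le hB hτ G)
      _ = F.wt * G.wt * (B ^ F.deg * B ^ G.deg) := by ring

/-- On points with coordinates in `[-1, 1]` the value is bounded by the weight
(Beigel–Tarui 1994, §2.4: "for any `x ∈ {0,1}ⁿ`, `-N ≤ p(x) ≤ N`"). [cite: BeigelTarui1994, §2.4] -/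
theorem abs_eval_le_wt {ν : σ → ℤ} (hν : ∀ v, |ν v| ≤ 1) : ∀ F : AForm σ, |F.eval ν| ≤ F.wt
  | var v => by simpa [eval, wt] using hν v
  | cst c => by
    simp only [eval, wt, Nat.cast_max, Nat.cast_one, Int.natCast_natAbs]
    exact le_max_right _ _
  | add F G => by
    simp only [eval, wt, Nat.cast_add]
    exact (abs_add_le _ _).trans (add_le_add (abs_eval_le_wt hν F) (abs_eval_le_wt hν G))
  | mul F G => by
    simp only [eval, wt, Nat.cast_mul, abs_mul]
    exact mul_le_mul (abs_eval_le_wt hν F) (abs_eval_le_wt hν G) (abs_nonneg _)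
      (Nat.cast_nonneg _)

/-- Congruent points give congruent values. [folklore] -/
theorem eval_modEq {K : ℤ} {ν ν' : σ → ℤ} (h : ∀ v, ν v ≡ ν' v [ZMOD K]) :
    ∀ F : AForm σ, F.eval ν ≡ F.eval ν' [ZMOD K]
  | var v => h v
  | cst _ => Int.ModEq.refl _
  | add F G => (eval_modEq h F).add (eval_modEq h G)
  | mul F G => (eval_modEq h F).mul (eval_modEq h G)

/-! #### Variables occurring -/

/-- All variables of `F` satisfy `P`. [folklore] -/
def VarsIn (P : σ → Prop) : AForm σ → Prop
  | var v => P v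
  | cst _ => True
  | add F G => F.VarsIn P ∧ G.VarsIn P
  | mul F G => F.VarsIn P ∧ G.VarsIn P

/-- Monotonicity of `VarsIn` in the predicate. [folklore] -/
theorem VarsIn.mono {P Q : σ → Prop} (hPQ : ∀ v, P v → Q v) : ∀ {F : AForm σ}, F.VarsIn P → F.VarsIn Q
  | var _, h => hPQ _ h
  | cst _, _ => trivial
  | add _ _, h => ⟨VarsIn.mono hPQ h.1, VarsIn.mono hPQ h.2⟩
  | mul _ _, h => ⟨VarsIn.mono hPQ h.1, VarsIn.mono hPQ h.2⟩

/-- The variables of a substitution instance. [folklore] -/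
theorem VarsIn_subst {P : σ → Prop} {Q : σ' → Prop} {τ : σ → AForm σ'}
    (hτ : ∀ v, P v → (τ v).VarsIn Q) : ∀ {F : AForm σ}, F.VarsIn P → (F.subst τ).VarsIn Q
  | var _, h => hτ _ h
  | cst _, _ => trivial
  | add _ _, h => ⟨VarsIn_subst hτ h.1, VarsIn_subst hτ h.2⟩
  | mul _ _, h => ⟨VarsIn_subst hτ h.1, VarsIn_subst hτ h.2⟩

/-- A formula only depends on the values of the variables occurring in it. [folklore] -/
theorem eval_congr_of_varsIn {P : σ → Prop} {ν ν' : σ → ℤ} (h : ∀ v, P v → ν v = ν' v) :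
    ∀ {F : AForm σ}, F.VarsIn P → F.eval ν = F.eval ν'
  | var _, hF => h _ hF
  | cst _, _ => rfl
  | add F G, hF => by rw [eval, eval, eval_congr_of_varsIn h hF.1, eval_congr_of_varsIn h hF.2]
  | mul F G, hF => by rw [eval, eval, eval_congr_of_varsIn h hF.1, eval_congr_of_varsIn h hF.2]

/-! #### Derived connectives -/

/-- Negation `-F`. [folklore] -/
def neg (F : AForm σ) : AForm σ := mul (cst (-1)) F

/-- `1 - F`. [folklore] -/
def oneSub (F : AForm σ) : AForm σ := add (cst 1) (neg F)

/-- Value of `-F`. [folklore] -/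
@[simp] theorem eval_neg (ν : σ → ℤ) (F : AForm σ) : F.neg.eval ν = -F.eval ν := by
  simp [neg, eval]

/-- Value of `1 - F`. [folklore] -/
@[simp] theorem eval_oneSub (ν : σ → ℤ) (F : AForm σ) : F.oneSub.eval ν = 1 - F.eval ν := by
  simp [oneSub, eval, sub_eq_add_neg]

/-- Degree of `-F`. [folklore] -/
@[simp] theorem deg_neg (F : AForm σ) : F.neg.deg = F.deg := by simp [neg, deg]

/-- Degree of `1 - F`. [folklore] -/
@[simp] theorem deg_oneSub (F : AForm σ) : F.oneSub.deg = F.deg := by simp [oneSub, deg]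

/-- Weight of `-F`. [folklore] -/
@[simp] theorem wt_neg (F : AForm σ) : F.neg.wt = F.wt := by simp [neg, wt]

/-- Weight of `1 - F`. [folklore] -/
@[simp] theorem wt_oneSub (F : AForm σ) : F.oneSub.wt = F.wt + 1 := by
  simp [oneSub, wt, Nat.add_comm]

/-- Substitution commutes with negation. [folklore] -/
@[simp] theorem subst_neg (τ : σ → AForm σ') (F : AForm σ) : F.neg.subst τ = (F.subst τ).neg := rfl

/-- Substitution commutes with `1 - ·`. [folklore] -/
@[simp] theorem subst_oneSub (τ : σ → AForm σ') (F : AForm σ) :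
    F.oneSub.subst τ = (F.subst τ).oneSub := rfl

/-- Variables of `-F`. [folklore] -/
theorem VarsIn.neg {P : σ → Prop} {F : AForm σ} (h : F.VarsIn P) : F.neg.VarsIn P := ⟨trivial, h⟩

/-- Variables of `1 - F`. [folklore] -/
theorem VarsIn.oneSub {P : σ → Prop} {F : AForm σ} (h : F.VarsIn P) : F.oneSub.VarsIn P :=
  ⟨trivial, h.neg⟩

/-- Sum of a list of formulas. [folklore] -/
def sumL : List (AForm σ) → AForm σ
  | [] => cst 0
  | F :: l => add F (sumL l)

/-- Product of a list of formulas. [folklore] -/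
def prodL : List (AForm σ) → AForm σ
  | [] => cst 1
  | F :: l => mul F (prodL l)

/-- Power. [folklore] -/
def pow (F : AForm σ) (k : ℕ) : AForm σ := prodL (List.replicate k F)

/-- Value of a list sum. [folklore] -/
@[simp] theorem eval_sumL (ν : σ → ℤ) : ∀ l : List (AForm σ), (sumL l).eval ν = (l.map (eval ν)).sum
  | [] => rfl
  | F :: l => by simp [sumL, eval, eval_sumL ν l]

/-- Value of a list product. [folklore] -/
@[simp] theorem eval_prodL (ν : σ → ℤ) : ∀ l : List (AForm σ), (prodL l).eval ν = (l.map (eval ν)).prod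
  | [] => rfl
  | F :: l => by simp [prodL, eval, eval_prodL ν l]

/-- Value of a power. [folklore] -/
@[simp] theorem eval_pow (ν : σ → ℤ) (F : AForm σ) (k : ℕ) : (F.pow k).eval ν = F.eval ν ^ k := by
  simp [pow, List.prod_replicate]

/-- Degree of a list sum: a uniform bound. [folklore] -/
theorem deg_sumL_le {D : ℕ} : ∀ {l : List (AForm σ)}, (∀ F ∈ l, F.deg ≤ D) → (sumL l).deg ≤ D
  | [], _ => Nat.zero_le _
  | F :: l, h => by
    simp only [sumL, deg]
    exact max_le (h F (by simp)) (deg_sumL_le fun G hG => h G (by simp [hG]))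

/-- Degree of a list product: the sum of the degrees. [folklore] -/
theorem deg_prodL : ∀ l : List (AForm σ), (prodL l).deg = (l.map deg).sum
  | [] => rfl
  | F :: l => by simp [prodL, deg, deg_prodL l]

/-- Sum of a constant list of naturals. [folklore] -/
theorem sum_map_const_nat {α : Type*} (l : List α) (D : ℕ) : (l.map fun _ => D).sum = l.length * D := by
  rw [List.map_const', List.sum_replicate, smul_eq_mul]

/-- Degree of a list product: a uniform bound. [folklore] -/
theorem deg_prodL_le {D : ℕ} {l : List (AForm σ)} (h : ∀ F ∈ l, F.deg ≤ D) : (prodL l).deg ≤ l.length * D := by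
  rw [deg_prodL, ← sum_map_const_nat l D]
  exact List.sum_le_sum (fun F hF => h F hF)

/-- Degree of a power. [folklore] -/
@[simp] theorem deg_pow (F : AForm σ) (k : ℕ) : (F.pow k).deg = k * F.deg := by
  simp [pow, deg_prodL, List.sum_replicate]

/-- Weight of a list sum. [folklore] -/
theorem wt_sumL : ∀ l : List (AForm σ), (sumL l).wt = (l.map wt).sum + 1
  | [] => rfl
  | F :: l => by simp [sumL, wt, wt_sumL l]; ring

/-- Weight of a list sum: a uniform bound. [folklore] -/
theorem wt_sumL_le {W : ℕ} {l : List (AForm σ)} (h : ∀ F ∈ l, F.wt ≤ W) : (sumL l).wt ≤ l.length * W + 1 := by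
  rw [wt_sumL, ← sum_map_const_nat l W]
  exact Nat.add_le_add_right (List.sum_le_sum (fun F hF => h F hF)) _

/-- Weight of a list product. [folklore] -/
theorem wt_prodL : ∀ l : List (AForm σ), (prodL l).wt = (l.map wt).prod
  | [] => rfl
  | F :: l => by simp [prodL, wt, wt_prodL l]

/-- Weight of a list product: a uniform bound. [folklore] -/
theorem wt_prodL_le {W : ℕ} {l : List (AForm σ)} (h : ∀ F ∈ l, F.wt ≤ W) : (prodL l).wt ≤ W ^ l.length := by
  rw [wt_prodL]
  induction l with
  | nil => simp
  | cons F l ih =>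
    simp only [List.map_cons, List.prod_cons, List.length_cons, Nat.pow_succ]
    rw [Nat.mul_comm (W ^ _)]
    exact Nat.mul_le_mul (h F (by simp)) (ih fun G hG => h G (by simp [hG]))

/-- Weight of a power. [folklore] -/
@[simp] theorem wt_pow (F : AForm σ) (k : ℕ) : (F.pow k).wt = F.wt ^ k := by
  simp [pow, wt_prodL, List.prod_replicate]

/-- Substitution commutes with list sums. [folklore] -/
theorem subst_sumL (τ : σ → AForm σ') : ∀ l : List (AForm σ), (sumL l).subst τ = sumL (l.map (subst τ))
  | [] => rfl
  | F :: l => by simp [sumL, subst, subst_sumL τ l]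

/-- Substitution commutes with list products. [folklore] -/
theorem subst_prodL (τ : σ → AForm σ') : ∀ l : List (AForm σ), (prodL l).subst τ = prodL (l.map (subst τ))
  | [] => rfl
  | F :: l => by simp [prodL, subst, subst_prodL τ l]

/-- Substitution commutes with powers. [folklore] -/
@[simp] theorem subst_pow (τ : σ → AForm σ') (F : AForm σ) (k : ℕ) : (F.pow k).subst τ = (F.subst τ).pow k := by
  simp [pow, subst_prodL]

/-- Variables of a list sum. [folklore] -/
theorem VarsIn_sumL {P : σ → Prop} : ∀ {l : List (AForm σ)}, (∀ F ∈ l, F.VarsIn P) → (sumL l).VarsIn P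
  | [], _ => trivial
  | F :: l, h => ⟨h F (by simp), VarsIn_sumL fun G hG => h G (by simp [hG])⟩

/-- Variables of a list product. [folklore] -/
theorem VarsIn_prodL {P : σ → Prop} : ∀ {l : List (AForm σ)}, (∀ F ∈ l, F.VarsIn P) → (prodL l).VarsIn P
  | [], _ => trivial
  | F :: l, h => ⟨h F (by simp), VarsIn_prodL fun G hG => h G (by simp [hG])⟩

/-- Variables of a power. [folklore] -/
theorem VarsIn.pow {P : σ → Prop} {F : AForm σ} (h : F.VarsIn P) (k : ℕ) : (F.pow k).VarsIn P :=
  VarsIn_prodL fun G hG => by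
    obtain ⟨-, rfl⟩ := List.mem_replicate.1 hG
    exact h

/-! #### Expansion into multilinear monomials on `{0,1}`-points -/

section expand

variable [DecidableEq σ]

/-- The expansion of a formula into signed multilinear monomials (a monomial is the set of its
variables: on `{0,1}`-points `xᵢ² = xᵢ`). [folklore] -/
def expand : AForm σ → List (ℤ × Finset σ)
  | var v => [(1, {v})]
  | cst c => [(c, ∅)]
  | add F G => F.expand ++ G.expand
  | mul F G => F.expand.flatMap fun p => G.expand.map fun q => (p.1 * q.1, p.2 ∪ q.2)

/-- The value of the monomial `∏_{v ∈ A} x_v` at a `{0,1}`-point: `1` iff all its variables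
are `1`. [folklore] -/
def mono (ν : σ → ℤ) (A : Finset σ) : ℤ := if ∀ v ∈ A, ν v = 1 then 1 else 0

/-- On `{0,1}`-points the monomial of a union is the product of the monomials (`xᵢ² = xᵢ`).
[folklore] -/
theorem mono_union (ν : σ → ℤ) (A B : Finset σ) : mono ν (A ∪ B) = mono ν A * mono ν B := by
  unfold mono
  have key : (∀ v ∈ A ∪ B, ν v = 1) ↔ (∀ v ∈ A, ν v = 1) ∧ ∀ v ∈ B, ν v = 1 := by
    simp only [Finset.mem_union, or_imp, forall_and]
  by_cases hA : ∀ v ∈ A, ν v = 1 <;> by_cases hB : ∀ v ∈ B, ν v = 1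
  · rw [if_pos (key.2 ⟨hA, hB⟩), if_pos hA, if_pos hB]; rfl
  · rw [if_neg (fun h => hB (key.1 h).2), if_pos hA, if_neg hB]; rfl
  · rw [if_neg (fun h => hA (key.1 h).1), if_neg hA, if_pos hB]; rfl
  · rw [if_neg (fun h => hA (key.1 h).1), if_neg hA, if_neg hB]; rfl

/-- Summing over a product of two lists. [folklore] -/
private theorem sum_flatMap_map {α β : Type*} (l₁ : List α) (l₂ : List β) (f : α → β → ℤ) :
    ((l₁.flatMap fun a => l₂.map fun b => f a b)).sum = (l₁.map fun a => (l₂.map fun b => f a b).sum).sum := by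
  induction l₁ with
  | nil => simp
  | cons a l ih => simp [List.flatMap_cons, List.sum_append, ih]

/-- **Expansion theorem**: on `{0,1}`-points a formula is the signed sum of its monomials.
[folklore] -/
theorem eval_eq_expand {ν : σ → ℤ} (hν : ∀ v, ν v = 0 ∨ ν v = 1) :
    ∀ F : AForm σ, F.eval ν = (F.expand.map fun p => p.1 * mono ν p.2).sum
  | var v => by
    rcases hν v with h | h <;> simp [eval, expand, mono, h]
  | cst c => by simp [eval, expand, mono]
  | add F G => by
    simp only [eval, expand, List.map_append, List.sum_append, eval_eq_expand hν F, eval_eq_expand hν G]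
  | mul F G => by
    rw [eval, eval_eq_expand hν F, eval_eq_expand hν G, expand]
    rw [List.map_flatMap]
    simp only [Function.comp_def, List.map_map]
    rw [sum_flatMap_map]
    rw [← List.sum_map_mul_right]  -- (Σ f) * c = Σ (f*c)?
    congr 1
    refine List.map_congr_left fun p _ => ?_
    rw [← List.sum_map_mul_left]
    congr 1
    refine List.map_congr_left fun q _ => ?_
    simp only [mono_union]
    ring

/-- Monomials of the expansion have at most `deg` variables. [folklore] -/
theorem card_le_deg_of_mem_expand : ∀ (F : AForm σ) {p : ℤ × Finset σ}, p ∈ F.expand → p.2.card ≤ F.deg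
  | var v, p, hp => by simp [expand] at hp; simp [hp, deg]
  | cst c, p, hp => by simp [expand] at hp; simp [hp, deg]
  | add F G, p, hp => by
    simp only [expand, List.mem_append] at hp
    rcases hp with hp | hp
    · exact (card_le_deg_of_mem_expand F hp).trans (le_max_left _ _)
    · exact (card_le_deg_of_mem_expand G hp).trans (le_max_right _ _)
  | mul F G, p, hp => by
    simp only [expand, List.mem_flatMap, List.mem_map] at hp
    obtain ⟨a, ha, b, hb, rfl⟩ := hp
    exact (Finset.card_union_le _ _).trans
      (Nat.add_le_add (card_le_deg_of_mem_expand F ha) (card_le_deg_of_mem_expand G hb))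

/-- The expansion has at most `wt` monomials. [folklore] -/
theorem length_expand_le_wt : ∀ F : AForm σ, F.expand.length ≤ F.wt
  | var _ => le_rfl
  | cst _ => le_max_left _ _
  | add F G => by
    simp only [expand, List.length_append, wt]
    exact Nat.add_le_add (length_expand_le_wt F) (length_expand_le_wt G)
  | mul F G => by
    simp only [expand, List.length_flatMap, List.length_map, wt]
    rw [sum_map_const_nat]
    exact Nat.mul_le_mul (length_expand_le_wt F) (length_expand_le_wt G)

/-- All variables of the monomials satisfy `P` if the formula's variables do. [folklore] -/
theorem forall_mem_expand_of_varsIn {P : σ → Prop} :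
    ∀ {F : AForm σ}, F.VarsIn P → ∀ p ∈ F.expand, ∀ v ∈ p.2, P v
  | var v, h, p, hp, w, hw => by
    simp [expand] at hp; subst hp; simp at hw; subst hw; exact h
  | cst c, _, p, hp, w, hw => by simp [expand] at hp; subst hp; simp at hw
  | add F G, h, p, hp, w, hw => by
    simp only [expand, List.mem_append] at hp
    rcases hp with hp | hp
    · exact forall_mem_expand_of_varsIn h.1 p hp w hw
    · exact forall_mem_expand_of_varsIn h.2 p hp w hw
  | mul F G, h, p, hp, w, hw => by
    simp only [expand, List.mem_flatMap, List.mem_map] at hp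
    obtain ⟨a, ha, b, hb, rfl⟩ := hp
    simp only [Finset.mem_union] at hw
    rcases hw with hw | hw
    · exact forall_mem_expand_of_varsIn h.1 a ha w hw
    · exact forall_mem_expand_of_varsIn h.2 b hb w hw

end expand

/-! #### Modulus amplification (Toda 1991 / Yao 1990 / Beigel–Tarui 1994, §1.4, §2.3) -/

/-- Yao's modulus-amplifying step `3N² - 2N³` (Beigel–Tarui 1994, §2.3: "Yao (1988) constructed
k-modulus-amplifying polynomials `Pₖ` starting with `P₂(x) = 3x² - 2x³`"). [cite: BeigelTarui1994, §2.3] -/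
def todaFun (N : ℤ) : ℤ := 3 * N ^ 2 - 2 * N ^ 3

/-- **Modulus amplification** (Beigel–Tarui 1994, §1.4/§2.3): `N ≡ b (mod M)` with `b ∈ {0,1}`
implies `3N² - 2N³ ≡ b (mod M²)`. [cite: BeigelTarui1994, §1.4] -/
theorem todaFun_modEq_sq {M N b : ℤ} (hb : b = 0 ∨ b = 1) (h : N ≡ b [ZMOD M]) :
    todaFun N ≡ b [ZMOD M ^ 2] := by
  obtain ⟨a, ha⟩ := (Int.modEq_iff_dvd.1 h.symm)
  -- ha : N - b = M * a
  have hN : N = b + M * a := by linarith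
  rcases hb with rfl | rfl
  · refine Int.modEq_iff_dvd.2 ⟨-(3 * a ^ 2 - 2 * a ^ 3 * M), ?_⟩
    rw [hN, todaFun]; ring
  · refine Int.modEq_iff_dvd.2 ⟨a ^ 2 * (2 * N + 1), ?_⟩
    have : N - 1 = M * a := by linarith
    calc (1 : ℤ) - todaFun N = (N - 1) ^ 2 * (2 * N + 1) := by rw [todaFun]; ring
      _ = M ^ 2 * (a ^ 2 * (2 * N + 1)) := by rw [this]; ring

/-- Iterated amplification: `N ≡ b (mod M)` implies `todaFun^[κ] N ≡ b (mod M^(2^κ))`. [cite: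
BeigelTarui1994, §2.3] -/
theorem todaFun_iterate_modEq {M N b : ℤ} (hb : b = 0 ∨ b = 1) (h : N ≡ b [ZMOD M]) (κ : ℕ) :
    todaFun^[κ] N ≡ b [ZMOD M ^ 2 ^ κ] := by
  induction κ with
  | zero => simpa using h
  | succ κ ih =>
    rw [Function.iterate_succ_apply', pow_succ, pow_mul]
    exact todaFun_modEq_sq hb ih

/-- The amplification step on formulas. [cite: BeigelTarui1994, §2.3] -/
def toda (F : AForm σ) : AForm σ :=
  add (mul (cst 3) (mul F F)) (mul (cst (-2)) (mul F (mul F F)))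

/-- `κ`-fold amplification on formulas. [cite: BeigelTarui1994, §2.3] -/
def todaIter : ℕ → AForm σ → AForm σ
  | 0, F => F
  | κ + 1, F => toda (todaIter κ F)

/-- Value of the amplification step. [cite: BeigelTarui1994, §2.3] -/
@[simp] theorem eval_toda (ν : σ → ℤ) (F : AForm σ) : F.toda.eval ν = todaFun (F.eval ν) := by
  simp [toda, eval, todaFun]; ring

/-- Value of the iterated amplification. [cite: BeigelTarui1994, §2.3] -/
@[simp] theorem eval_todaIter (ν : σ → ℤ) (F : AForm σ) : ∀ κ, (todaIter κ F).eval ν = todaFun^[κ] (F.eval ν)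
  | 0 => rfl
  | κ + 1 => by rw [todaIter, eval_toda, eval_todaIter ν F κ, Function.iterate_succ_apply']

/-- The amplification step triples the degree. [cite: BeigelTarui1994, §2.3] -/
@[simp] theorem deg_toda (F : AForm σ) : F.toda.deg = 3 * F.deg := by
  simp only [toda, deg, Nat.zero_add]
  omega

/-- Degree of the iterated amplification: `3^κ · deg`. [cite: BeigelTarui1994, §2.3] -/
@[simp] theorem deg_todaIter (F : AForm σ) : ∀ κ, (todaIter κ F).deg = 3 ^ κ * F.deg
  | 0 => by simp [todaIter]
  | κ + 1 => by rw [todaIter, deg_toda, deg_todaIter F κ, pow_succ]; ring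

/-- Weight of the amplification step. [cite: BeigelTarui1994, §2.3] -/
theorem wt_toda (F : AForm σ) : F.toda.wt = 3 * F.wt ^ 2 + 2 * F.wt ^ 3 := by
  simp [toda, wt]; ring

/-- Weight of the iterated amplification: `5 · wt ≤ (5 · wt F)^(3^κ)`. [cite: BeigelTarui1994, §2.3] -/
theorem wt_todaIter_le (F : AForm σ) : ∀ κ, 5 * (todaIter κ F).wt ≤ (5 * F.wt) ^ 3 ^ κ
  | 0 => by simp [todaIter]
  | κ + 1 => by
    rw [todaIter, wt_toda, show (5 * F.wt) ^ 3 ^ (κ + 1) = ((5 * F.wt) ^ 3 ^ κ) ^ 3 by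
      rw [← pow_mul, ← pow_succ]]
    refine le_trans ?_ (Nat.pow_le_pow_left (wt_todaIter_le F κ) 3)
    have h1 := one_le_wt (todaIter κ F)
    set w := (todaIter κ F).wt
    calc 5 * (3 * w ^ 2 + 2 * w ^ 3) ≤ 5 * (3 * w ^ 3 + 2 * w ^ 3) := by
          have : w ^ 2 ≤ w ^ 3 := Nat.pow_le_pow_right h1 (by norm_num)
          nlinarith
      _ = 25 * w ^ 3 := by ring
      _ ≤ 125 * w ^ 3 := Nat.mul_le_mul_right _ (by norm_num)
      _ = (5 * w) ^ 3 := by ring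

/-- Substitution commutes with the amplification step. [folklore] -/
@[simp] theorem subst_toda (τ : σ → AForm σ') (F : AForm σ) : F.toda.subst τ = (F.subst τ).toda := rfl

/-- Substitution commutes with the iterated amplification. [folklore] -/
@[simp] theorem subst_todaIter (τ : σ → AForm σ') (F : AForm σ) :
    ∀ κ, (todaIter κ F).subst τ = todaIter κ (F.subst τ)
  | 0 => rfl
  | κ + 1 => by rw [todaIter, subst_toda, subst_todaIter τ F κ]; rfl

/-- The amplification step introduces no variables. [folklore] -/
theorem VarsIn.toda {P : σ → Prop} {F : AForm σ} (h : F.VarsIn P) : F.toda.VarsIn P :=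
  ⟨⟨trivial, h, h⟩, trivial, h, h, h⟩

/-- The iterated amplification introduces no variables. [folklore] -/
theorem VarsIn.todaIter {P : σ → Prop} {F : AForm σ} (h : F.VarsIn P) : ∀ κ, (todaIter κ F).VarsIn P
  | 0 => h
  | κ + 1 => (VarsIn.todaIter h κ).toda

/-! #### Fermat: the indicator of a modular gate -/

/-- The `{0,1}`-indicator of `¬ (p ∣ e)`, as an integer. [folklore] -/
def indNZ (p : ℕ) (e : ℤ) : ℤ := if e % p = 0 then 0 else 1

/-- `indNZ` is `{0,1}`-valued. [folklore] -/
theorem indNZ_zero_or_one (p : ℕ) (e : ℤ) : indNZ p e = 0 ∨ indNZ p e = 1 := by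
  unfold indNZ; split_ifs <;> simp

/-- Fermat's little theorem in indicator form: `e^(p-1) ≡ [p ∤ e] (mod p)` (Beigel–Tarui 1994,
proof of Lemma 2.1). [cite: BeigelTarui1994, Lemma 2.1] -/
theorem pow_pred_modEq_indNZ {p : ℕ} (hp : p.Prime) (e : ℤ) : e ^ (p - 1) ≡ indNZ p e [ZMOD p] := by
  unfold indNZ
  split_ifs with h
  · have hd : (p : ℤ) ∣ e := Int.dvd_of_emod_eq_zero h
    have : (p : ℤ) ∣ e ^ (p - 1) := dvd_pow hd (Nat.sub_ne_zero_of_lt hp.one_lt)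
    exact (Int.emod_eq_zero_of_dvd this).trans (by simp) 
  · have hnd : ¬ (p : ℤ) ∣ e := fun hd => h (Int.emod_eq_zero_of_dvd hd)
    have hirr : Irreducible (p : ℤ) := (Nat.prime_iff_prime_int.1 hp).irreducible
    have hcop : IsCoprime e (p : ℤ) := ((Irreducible.coprime_iff_not_dvd hirr).2 hnd).symm
    exact Int.ModEq.pow_card_sub_one_eq_one hp hcop

/-! #### The collapse step (Beigel–Tarui 1994, Fact 2.7 / Lemma 2.8) -/

/-- Decoding a bounded integer from its residue. [cite: BeigelTarui1994, §2.4] -/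
theorem decode_eq {z a W K : ℤ} (hK : 2 * W < K) (ha : |a| ≤ W) (h : z ≡ a [ZMOD K]) :
    (z + W) % K - W = a := by
  have h1 : (z + W) % K = (a + W) % K := (h.add_right W)
  rw [h1, Int.emod_eq_of_lt] <;> [ring_nf; skip; skip]
  · cases abs_le.1 ha; linarith
  · cases abs_le.1 ha; linarith

/-- The substitution of one collapse step: the variables in the batch `B` are replaced by the
amplified Fermat powers of their gate polynomials. [cite: BeigelTarui1994, Lemma 2.8] -/
def collapseSubst (B : σ → Prop) [DecidablePred B] (F : σ → AForm σ) (p κ : ℕ) (v : σ) : AForm σ :=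
  if B v then todaIter κ ((F v).pow (p - 1)) else var v

/-- **The collapse congruence** (Beigel–Tarui 1994, Fact 2.7 and proof of Lemma 2.8): if every
batch variable `v ∈ B` carries the modular gate value `[F_v(ν) ≢ 0 (mod p)]`, then substituting
`todaIter κ (F_v^(p-1))` for `v` preserves the value of any formula modulo `p^(2^κ)`. [cite: BeigelTarui1994, Lemma 2.8] -/
theorem eval_modEq_eval_collapse {B : σ → Prop} [DecidablePred B] {F : σ → AForm σ} {p : ℕ}
    (hp : p.Prime) (κ : ℕ) {ν : σ → ℤ} (hB : ∀ v, B v → ν v = indNZ p ((F v).eval ν)) (R : AForm σ) :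
    R.eval ν ≡ (R.subst (collapseSubst B F p κ)).eval ν [ZMOD (p : ℤ) ^ 2 ^ κ] := by
  rw [eval_subst]
  refine eval_modEq (fun v => ?_) R
  unfold collapseSubst
  split_ifs with hv
  · rw [eval_todaIter, eval_pow, hB v hv]
    exact (todaFun_iterate_modEq (indNZ_zero_or_one _ _) (pow_pred_modEq_indNZ hp _) κ).symm
  · rfl

/-- Degree of the collapse substitution. [cite: BeigelTarui1994, Lemma 2.8] -/
theorem deg_collapseSubst_le {B : σ → Prop} [DecidablePred B] {F : σ → AForm σ} {p κ D : ℕ}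
    (hD : ∀ v, B v → (F v).deg ≤ D) (v : σ) :
    (collapseSubst B F p κ v).deg ≤ max 1 (3 ^ κ * ((p - 1) * D)) := by
  unfold collapseSubst
  split_ifs with hv
  · rw [deg_todaIter, deg_pow]
    exact le_max_of_le_right (Nat.mul_le_mul_left _ (Nat.mul_le_mul_left _ (hD v hv)))
  · exact le_max_left _ _

/-- Weight of the collapse substitution. [cite: BeigelTarui1994, Lemma 2.8] -/
theorem wt_collapseSubst_le {B : σ → Prop} [DecidablePred B] {F : σ → AForm σ} {p κ W : ℕ}
    (hW1 : 1 ≤ W) (hW : ∀ v, B v → (F v).wt ≤ W) (v : σ) :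
    (collapseSubst B F p κ v).wt ≤ (5 * W ^ (p - 1)) ^ 3 ^ κ := by
  unfold collapseSubst
  split_ifs with hv
  · refine le_trans ?_ ((wt_todaIter_le _ κ).trans (Nat.pow_le_pow_left
      (Nat.mul_le_mul_left _ (by rw [wt_pow]; exact Nat.pow_le_pow_left (hW v hv) _)) _))
    exact Nat.le_mul_of_pos_left _ (by norm_num)
  · show 1 ≤ _
    exact Nat.one_le_pow _ _ (Nat.mul_pos (by norm_num) (Nat.pow_pos hW1))

/-- Variables of the collapse substitution: those of the substituted gate polynomials, and the
untouched variables. [cite: BeigelTarui1994, Lemma 2.8] -/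
theorem VarsIn_collapseSubst {B : σ → Prop} [DecidablePred B] {F : σ → AForm σ} {p κ : ℕ}
    {P Q : σ → Prop} (hF : ∀ v, B v → (F v).VarsIn Q) (hPQ : ∀ v, P v → ¬ B v → Q v) (v : σ) (hv : P v) :
    (collapseSubst B F p κ v).VarsIn Q := by
  unfold collapseSubst
  split_ifs with hB
  · exact ((hF v hB).pow _).todaIter κ
  · exact hPQ v hv hB

end AForm

open Finset

namespace Derand

/-! #### Parity classes have equal size -/

/-- Flipping one coordinate of a Boolean vector. [folklore] -/
def flipAt {α : Type*} [DecidableEq α] (a₀ : α) (β : α → Bool) : α → Bool :=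
  Function.update β a₀ (!β a₀)

/-- Flipping a coordinate twice is the identity. [folklore] -/
theorem flipAt_flipAt {α : Type*} [DecidableEq α] (a₀ : α) (β : α → Bool) :
    flipAt a₀ (flipAt a₀ β) = β := by
  funext a
  unfold flipAt
  by_cases h : a = a₀
  · subst h; simp
  · simp [Function.update_of_ne h]

/-- If flipping the coordinate `a₀` always changes the parity of `f`, then exactly half of the
Boolean vectors give `f` even. [folklore] -/
theorem two_mul_card_even_eq {α : Type*} [DecidableEq α] [Fintype α] (f : (α → Bool) → ℕ) (a₀ : α)
    (hf : ∀ β, Even (f (flipAt a₀ β)) ↔ ¬ Even (f β)) :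
    2 * #(univ.filter fun β => Even (f β)) = 2 ^ Fintype.card α := by
  have hodd : #(univ.filter fun β => ¬ Even (f β)) = #(univ.filter fun β => Even (f β)) := by
    refine Finset.card_bij (fun β _ => flipAt a₀ β) (fun β hβ => ?_) (fun β₁ _ β₂ _ h => ?_)
      (fun β hβ => ⟨flipAt a₀ β, ?_, flipAt_flipAt a₀ β⟩)
    · simp only [mem_filter, mem_univ, true_and] at hβ ⊢
      by_contra h
      exact hβ (by have := (hf β); tauto)
    · simpa [flipAt_flipAt] using congrArg (flipAt a₀) h
    · simp only [mem_filter, mem_univ, true_and] at hβ ⊢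
      rw [hf, not_not]
      exact hβ
  have htot := Finset.card_filter_add_card_filter_not (s := (univ : Finset (α → Bool)))
    (fun β => Even (f β))
  rw [hodd, card_univ, Fintype.card_fun, Fintype.card_bool] at htot
  omega

/-- The isolation count (Razborov 1987 / Smolensky 1987, as used in Beigel–Tarui 1994, Remark 2.4,
here modulo `2`): if `v ≠ 0` then for exactly half of the subsets `β` of the coordinates the
number of selected ones of `v` is even. [cite: BeigelTarui1994, Remark 2.4] -/
theorem two_mul_card_even_count_eq {α : Type*} [DecidableEq α] [Fintype α] {k : ℕ} (ι : Fin k → α)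
    (hι : Function.Injective ι) (v : Fin k → Bool) (a₀ : Fin k) (ha₀ : v a₀ = true) :
    2 * #(univ.filter fun β : α → Bool => Even #(univ.filter fun a => v a = true ∧ β (ι a) = true)) =
      2 ^ Fintype.card α := by
  refine two_mul_card_even_eq _ (ι a₀) fun β => ?_
  -- the two filtered sets differ exactly in `a₀`
  set S := univ.filter fun a => v a = true ∧ β (ι a) = true with hS
  set S' := univ.filter fun a => v a = true ∧ flipAt (ι a₀) β (ι a) = true with hS'
  have key : ∀ a, a ∈ S' ↔ (a ≠ a₀ ∧ a ∈ S) ∨ (a = a₀ ∧ a₀ ∉ S) := by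
    intro a
    by_cases h : a = a₀
    · subst h
      simp [hS, hS', flipAt, ha₀]
    · have hne : ι a ≠ ι a₀ := fun e => h (hι e)
      simp [hS, hS', flipAt, Function.update_of_ne hne, h]
  by_cases h0 : a₀ ∈ S
  · -- S' = S.erase a₀
    have : S' = S.erase a₀ := by
      ext a; rw [key, mem_erase]; tauto
    rw [this, card_erase_of_mem h0]
    have hpos : 0 < #S := card_pos.2 ⟨a₀, h0⟩
    rw [Nat.even_sub (by omega)]
    simp
  · have : S' = insert a₀ S := by
      ext a; rw [key, mem_insert]
      constructor
      · rintro (⟨-, h⟩ | ⟨rfl, -⟩)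
        · exact Or.inr h
        · exact Or.inl rfl
      · rintro (rfl | h)
        · exact Or.inr ⟨rfl, h0⟩
        · exact Or.inl ⟨fun e => h0 (e ▸ h), h⟩
    rw [this, card_insert_of_notMem h0, Nat.even_add_one]

/-! #### Product counting -/

/-- The number of dependent functions all of whose values satisfy given predicates. [folklore] -/
theorem card_filter_pi {I : Type*} [Fintype I] [DecidableEq I] {X : I → Type*} [∀ i, Fintype (X i)]
    [∀ i, DecidableEq (X i)]
    (p : ∀ i, X i → Prop) [∀ i, DecidablePred (p i)] :
    #(univ.filter fun f : (∀ i, X i) => ∀ i, p i (f i)) = ∏ i, #(univ.filter fun x => p i x) := by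
  rw [← Fintype.card_subtype]
  simp_rw [← Fintype.card_subtype]
  rw [← Fintype.card_pi]
  exact Fintype.card_congr (Equiv.subtypePiEquivPi)

/-- One block of coordinates constrained to events of probability `≤ 1/2` each: the constrained
functions are at most a `2^{-T₀}` fraction. [folklore] -/
theorem card_constrained_mul_le {s₀ T₀ : ℕ} {X : Type*} [Fintype X] [DecidableEq X] (j : Fin s₀)
    (E : Fin T₀ → X → Prop) [∀ t, DecidablePred (E t)]
    (hE : ∀ t, 2 * #(univ.filter fun x => E t x) ≤ Fintype.card X) :
    2 ^ T₀ * #(univ.filter fun ω : Fin s₀ → Fin T₀ → X => ∀ t, E t (ω j t)) ≤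
      Fintype.card (Fin s₀ → Fin T₀ → X) := by
  -- uncurry
  have h1 : #(univ.filter fun ω : Fin s₀ → Fin T₀ → X => ∀ t, E t (ω j t)) =
      #(univ.filter fun g : Fin s₀ × Fin T₀ → X => ∀ i : Fin s₀ × Fin T₀, i.1 = j → E i.2 (g i)) := by
    refine Finset.card_bij (fun ω _ => Function.uncurry ω) (fun ω hω => ?_) (fun ω₁ _ ω₂ _ h => ?_)
      (fun g hg => ⟨Function.curry g, ?_, by simp⟩)
    · simp only [mem_filter, mem_univ, true_and] at hω ⊢
      rintro ⟨i1, i2⟩ (rfl : i1 = j)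
      exact hω i2
    · exact (Equiv.curry _ _ _).symm.injective h
    · simp only [mem_filter, mem_univ, true_and] at hg ⊢
      exact fun t => hg ⟨j, t⟩ rfl
  have h2 : Fintype.card (Fin s₀ → Fin T₀ → X) = Fintype.card (Fin s₀ × Fin T₀ → X) :=
    Fintype.card_congr (Equiv.curry _ _ _).symm
  have h3 : #(univ.filter fun g : Fin s₀ × Fin T₀ → X => ∀ i : Fin s₀ × Fin T₀, i.1 = j → E i.2 (g i)) =
      ∏ i : Fin s₀ × Fin T₀, #(univ.filter fun x => i.1 = j → E i.2 x) :=
    card_filter_pi (fun (i : Fin s₀ × Fin T₀) x => i.1 = j → E i.2 x)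
  rw [h1, h2, h3, Fintype.card_fun]
  -- ∏ i, #{x | q i x} with 2^T₀ = ∏_{i.1 = j} 2
  have hq : ∀ i : Fin s₀ × Fin T₀, #(univ.filter fun x => i.1 = j → E i.2 x) =
      if i.1 = j then #(univ.filter fun x => E i.2 x) else Fintype.card X := by
    rintro ⟨i1, i2⟩
    by_cases h : i1 = j
    · simp [h]
    · simp [h]
  simp_rw [hq]
  have hT : 2 ^ T₀ = ∏ i : Fin s₀ × Fin T₀, if i.1 = j then 2 else 1 := by
    rw [Finset.prod_ite, Finset.prod_const_one, mul_one, Finset.prod_const]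
    congr 1
    rw [show (univ.filter fun i : Fin s₀ × Fin T₀ => i.1 = j) = ({j} : Finset (Fin s₀)) ×ˢ univ by
      ext ⟨a, b⟩; simp [eq_comm]]
    simp
  rw [hT, ← Finset.prod_mul_distrib]
  calc _ ≤ ∏ _i : Fin s₀ × Fin T₀, Fintype.card X := by
        refine Finset.prod_le_prod' fun i _ => ?_
        split_ifs with h
        · exact hE i.2
        · simp
    _ = _ := by rw [prod_const, card_univ]

/-! #### Majority derandomization -/

/-- Functions bad on a prescribed set `B` of coordinates. [folklore] -/
theorem card_forall_mem_bad {T : ℕ} {Ω : Type*} [Fintype Ω] [DecidableEq Ω] (bad : Ω → Prop)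
    [DecidablePred bad] (B : Finset (Fin T)) :
    #(univ.filter fun ωs : Fin T → Ω => ∀ c ∈ B, bad (ωs c)) =
      #(univ.filter bad) ^ #B * Fintype.card Ω ^ (T - #B) := by
  have h0 : #(univ.filter fun ωs : Fin T → Ω => ∀ c ∈ B, bad (ωs c)) =
      ∏ c : Fin T, #(univ.filter fun x => c ∈ B → bad x) := by
    convert card_filter_pi (I := Fin T) (X := fun _ => Ω) (fun c x => c ∈ B → bad x) using 3
  rw [h0]
  have hq : ∀ c : Fin T, #(univ.filter fun x => c ∈ B → bad x) =
      if c ∈ B then #(univ.filter bad) else Fintype.card Ω := by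
    intro c; by_cases h : c ∈ B <;> simp [h]
  simp_rw [hq]
  have e1 : (univ.filter fun c : Fin T => c ∈ B) = B := by ext; simp
  have e2 : (univ.filter fun c : Fin T => ¬ c ∈ B) = Bᶜ := by ext; simp
  rw [Finset.prod_ite, Finset.prod_const, Finset.prod_const, e1, e2, Finset.card_compl,
    Fintype.card_fin]

/-- **Majority derandomization by counting** (the nonconstructive argument of Beigel–Tarui 1994,
Remark 2.4 / Lemma 2.5, with a direct union bound in place of the Chernoff bound): if for every
input `x` at most a `1/16` fraction of the seeds is bad, then some `T > n` seeds are such that,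
for every one of the `≤ 2ⁿ` inputs, fewer than half of them are bad. [cite: BeigelTarui1994, Remark 2.4] -/
theorem exists_majority_good {X Ω : Type*} [Fintype X] [Fintype Ω] [DecidableEq Ω] [Nonempty Ω]
    (Bad : X → Ω → Prop) [∀ x, DecidablePred (Bad x)] {n T : ℕ} (hX : Fintype.card X ≤ 2 ^ n)
    (hT : n < T) (hBad : ∀ x, 16 * #(univ.filter fun ω => Bad x ω) ≤ Fintype.card Ω) :
    ∃ ωs : Fin T → Ω, ∀ x, 2 * #(univ.filter fun c : Fin T => Bad x (ωs c)) < T := by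
  classical
  set N := Fintype.card Ω with hN
  -- per input: 2^T * #{bad-majority seeds} ≤ N^T
  have per_x : ∀ x, 2 ^ T * #(univ.filter fun ωs : Fin T → Ω =>
      T ≤ 2 * #(univ.filter fun c => Bad x (ωs c))) ≤ N ^ T := by
    intro x
    set badset : (Fin T → Ω) → Finset (Fin T) := fun ωs => univ.filter fun c => Bad x (ωs c) with hbs
    have step1 : #(univ.filter fun ωs : Fin T → Ω => T ≤ 2 * #(badset ωs)) ≤
        ∑ B ∈ (univ : Finset (Finset (Fin T))).filter (fun B => T ≤ 2 * #B),
          #(univ.filter fun ωs : Fin T → Ω => ∀ c ∈ B, Bad x (ωs c)) := by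
      rw [Finset.card_eq_sum_card_fiberwise (f := badset) (t := (univ : Finset (Finset (Fin T))).filter
        (fun B => T ≤ 2 * #B)) (fun ωs hωs => by simpa using hωs)]
      refine Finset.sum_le_sum fun B hB => Finset.card_le_card fun ωs hωs => ?_
      simp only [mem_filter, mem_univ, true_and] at hωs ⊢
      intro c hc
      rw [← hωs.2] at hc
      simpa [hbs] using hc
    have step2 : ∀ B : Finset (Fin T), T ≤ 2 * #B →
        4 ^ T * #(univ.filter fun ωs : Fin T → Ω => ∀ c ∈ B, Bad x (ωs c)) ≤ N ^ T := by
      intro B hB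
      rw [card_forall_mem_bad]
      have hb16 : 16 ^ #B * #(univ.filter (Bad x)) ^ #B ≤ N ^ #B := by
        rw [← mul_pow]; exact Nat.pow_le_pow_left (hBad x) _
      have hBT : #B ≤ T := by simpa using B.card_le_univ
      calc 4 ^ T * (#(univ.filter (Bad x)) ^ #B * N ^ (T - #B))
          ≤ 16 ^ #B * (#(univ.filter (Bad x)) ^ #B * N ^ (T - #B)) := by
            refine Nat.mul_le_mul_right _ ?_
            calc 4 ^ T ≤ 4 ^ (2 * #B) := Nat.pow_le_pow_right (by norm_num) hB
              _ = 16 ^ #B := by rw [pow_mul]; norm_num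
        _ = (16 ^ #B * #(univ.filter (Bad x)) ^ #B) * N ^ (T - #B) := by ring
        _ ≤ N ^ #B * N ^ (T - #B) := Nat.mul_le_mul_right _ hb16
        _ = N ^ T := by rw [← pow_add, Nat.add_sub_cancel' hBT]
    have step3 : 4 ^ T * #(univ.filter fun ωs : Fin T → Ω => T ≤ 2 * #(badset ωs)) ≤ 2 ^ T * N ^ T := by
      refine (Nat.mul_le_mul_left _ step1).trans ?_
      rw [Finset.mul_sum]
      calc ∑ B ∈ univ.filter (fun B : Finset (Fin T) => T ≤ 2 * #B),
            4 ^ T * #(univ.filter fun ωs : Fin T → Ω => ∀ c ∈ B, Bad x (ωs c))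
          ≤ ∑ B ∈ univ.filter (fun B : Finset (Fin T) => T ≤ 2 * #B), N ^ T :=
            Finset.sum_le_sum fun B hB => step2 B (by simpa using hB)
        _ = #(univ.filter (fun B : Finset (Fin T) => T ≤ 2 * #B)) * N ^ T := by rw [sum_const, smul_eq_mul]
        _ ≤ 2 ^ T * N ^ T := by
            refine Nat.mul_le_mul_right _ ?_
            calc #(univ.filter (fun B : Finset (Fin T) => T ≤ 2 * #B)) ≤ #(univ : Finset (Finset (Fin T))) :=
                  card_le_card (filter_subset _ _)
              _ = 2 ^ T := by simp
    have h4 : (4 : ℕ) ^ T = 2 ^ T * 2 ^ T := by rw [← mul_pow]; norm_num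
    rw [h4, mul_assoc] at step3
    exact Nat.le_of_mul_le_mul_left step3 (by positivity)
  -- sum over inputs
  have total : ∑ x, #(univ.filter fun ωs : Fin T → Ω => T ≤ 2 * #(univ.filter fun c => Bad x (ωs c))) <
      Fintype.card (Fin T → Ω) := by
    have hNpos : 0 < N := Fintype.card_pos
    have h1 : 2 ^ T * ∑ x, #(univ.filter fun ωs : Fin T → Ω => T ≤ 2 * #(univ.filter fun c => Bad x (ωs c))) ≤
        Fintype.card X * N ^ T := by
      rw [Finset.mul_sum]
      calc _ ≤ ∑ _x : X, N ^ T := Finset.sum_le_sum fun x _ => per_x x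
        _ = Fintype.card X * N ^ T := by rw [sum_const, smul_eq_mul, card_univ]
    have h2 : Fintype.card X * N ^ T < 2 ^ T * N ^ T :=
      Nat.mul_lt_mul_of_lt_of_le (hX.trans_lt (Nat.pow_lt_pow_right (by norm_num) hT)) le_rfl
        (by positivity)
    rw [Fintype.card_fun, Fintype.card_fin, ← hN]
    exact Nat.lt_of_mul_lt_mul_left (h1.trans_lt h2)
  -- pigeonhole
  by_contra hcon
  simp only [not_exists, not_forall, not_lt] at hcon
  have hcov : (univ : Finset (Fin T → Ω)) ⊆ (univ : Finset X).biUnion fun x =>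
      univ.filter fun ωs : Fin T → Ω => T ≤ 2 * #(univ.filter fun c => Bad x (ωs c)) := by
    intro ωs _
    obtain ⟨x, hx⟩ := hcon ωs
    exact mem_biUnion.2 ⟨x, mem_univ _, by simpa using hx⟩
  have := (card_le_card hcov).trans Finset.card_biUnion_le
  rw [card_univ] at this
  exact absurd total (not_lt.2 this)

end Derand

open Finset GateList

namespace BT
/-! ### Gates of `accBasis m`: symbolic codes and truth tables -/

variable {ι : Type*}

/-- Gate functions of `accBasis m` have code `≤ 3`. [folklore] -/
theorem accCode_le_three {m : ℕ} {f : GateFn} (h : f ∈ accBasis m) : accCode m f ≤ 3 := by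
  unfold accCode
  split_ifs with h0 h1 h2 h3
  · omega
  · omega
  · omega
  · omega
  exfalso
  simp only [accBasis, acBasis, Set.mem_union, Set.mem_singleton_iff, Set.mem_iUnion,
    Set.mem_insert_iff] at h
  rcases h with (h | ⟨k, h | h⟩) | ⟨k, h⟩
  · exact h0 h
  · exact h1 (by rw [h]; rfl)
  · exact h2 (by rw [h]; rfl)
  · exact h3 (by rw [h]; rfl)

/-- Code `0`: the gate function is `¬`. [folklore] -/
theorem fn_eq_not_of_accCode {m : ℕ} {f : GateFn} (h : accCode m f = 0) : f = GateFn.not := by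
  unfold accCode at h; split_ifs at h with h0; exact h0

/-- Code `1`: the gate function is a conjunction. [folklore] -/
theorem fn_eq_and_of_accCode {m : ℕ} {f : GateFn} (h : accCode m f = 1) : f = GateFn.and f.1 := by
  unfold accCode at h; split_ifs at h with h0 h1 <;> first | exact h1 | omega

/-- Code `2`: the gate function is a disjunction. [folklore] -/
theorem fn_eq_or_of_accCode {m : ℕ} {f : GateFn} (h : accCode m f = 2) : f = GateFn.or f.1 := by
  unfold accCode at h; split_ifs at h with h0 h1 h2 <;> first | exact h2 | omega

/-- Code `3`: the gate function is `MODₘ`. [folklore] -/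
theorem fn_eq_mod_of_accCode {m : ℕ} {f : GateFn} (h : accCode m f = 3) : f = GateFn.modGate m f.1 := by
  unfold accCode at h; split_ifs at h with h0 h1 h2 h3 <;> first | exact h3 | omega

/-- The code of `¬` is `0`. [folklore] -/
@[simp] theorem accCode_not (m : ℕ) : accCode m GateFn.not = 0 := by simp [accCode]

/-- A gate whose gate function is `⟨g.arity, op⟩` has truth table `op`. [folklore] -/
theorem Gate.op_eq_of_fn_eq {g : Gate ι} {op : (Fin g.arity → Bool) → Bool} (h : g.fn = ⟨g.arity, op⟩) :
    g.op = op := by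
  obtain ⟨k, op', args⟩ := g
  simp only [Gate.fn, Sigma.mk.injEq, heq_eq_eq, true_and] at h
  exact h

/-- Truth table of a gate of code `1`: conjunction. [folklore] -/
theorem op_and_of_accCode {m : ℕ} {g : Gate ι} (h : accCode m g.fn = 1) (v : Fin g.arity → Bool) :
    g.op v = decide (∀ i, v i = true) := by
  rw [Gate.op_eq_of_fn_eq (fn_eq_and_of_accCode h)]
  rfl

/-- Truth table of a gate of code `2`: disjunction. [folklore] -/
theorem op_or_of_accCode {m : ℕ} {g : Gate ι} (h : accCode m g.fn = 2) (v : Fin g.arity → Bool) :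
    g.op v = decide (∃ i, v i = true) := by
  rw [Gate.op_eq_of_fn_eq (fn_eq_or_of_accCode h)]
  rfl

/-- Truth table of a gate of code `3`: `MODₘ` (true iff the number of ones is not divisible by `m`).
[folklore] -/
theorem op_mod_of_accCode {m : ℕ} {g : Gate ι} (h : accCode m g.fn = 3) (v : Fin g.arity → Bool) :
    g.op v = decide (GateFn.numOnes v % m ≠ 0) := by
  rw [Gate.op_eq_of_fn_eq (fn_eq_mod_of_accCode h)]
  rfl

/-- The first argument wire of a gate, if any. [folklore] -/
def arg0 (g : Gate ι) : Option (ι ⊕ ℕ) := if h : 0 < g.arity then some (g.args ⟨0, h⟩) else none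

/-- The argument of a NOT gate. [folklore] -/
theorem notGate_arg0 (w : ι ⊕ ℕ) : arg0 (notGate w) = some w := rfl

/-- A gate of code `0` is a NOT gate. [folklore] -/
theorem exists_notGate_of_accCode {m : ℕ} {g : Gate ι} (h : accCode m g.fn = 0) : ∃ w, g = notGate w :=
  exists_eq_notGate_of_fn_eq (fn_eq_not_of_accCode h)

/-- `acWeight` of a gate with nonzero code is `1`. [folklore] -/
theorem acWeight_eq_one_of_accCode_ne {m : ℕ} {f : GateFn} (h : accCode m f ≠ 0) : acWeight f = 1 := by
  unfold acWeight
  rw [if_neg]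
  intro hf
  exact h (by rw [hf]; exact accCode_not m)

/-! ### Fan-in -/

/-- Every gate has arity at most `maxFanIn`. [folklore] -/
theorem arity_le_maxFanIn (C : Circuit ι) {g : Gate ι} (hg : g ∈ C.gates) : g.arity ≤ C.maxFanIn := by
  unfold Circuit.maxFanIn
  obtain ⟨gates, o, wf, wfo⟩ := C
  simp only at hg ⊢
  clear wf wfo
  induction gates with
  | nil => simp at hg
  | cons u gs ih =>
    simp only [List.map_cons, List.foldr_cons]
    rcases List.mem_cons.1 hg with rfl | h'
    · exact le_max_left _ _
    · exact (ih h').trans (le_max_right _ _)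

/-! ### Depths: the gate equation -/

/-- **The depth equation**: the weighted depth of gate `j` is its weight plus the largest depth of
its argument wires. [folklore] -/
theorem getD_wdepths_eq (w : GateFn → ℕ) (C : Circuit ι) (j : ℕ) (hj : j < C.gates.length) :
    (wdepths w C.gates).getD j 0 =
      w (C.gates[j]).fn + univ.sup fun a => wireDepthOf (wdepths w C.gates) ((C.gates[j]).args a) := by
  obtain ⟨ws, hws⟩ := wdepths_append_take w (C.gates.take j ++ [C.gates[j]]) (C.gates.drop (j + 1))
  have hsplit : C.gates.take j ++ [C.gates[j]] ++ C.gates.drop (j + 1) = C.gates := by simp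
  have hlen : (C.gates.take j).length = j := by simp; omega
  rw [hsplit] at hws
  have h2 := getD_wdepths_append_singleton w (C.gates.take j) (C.gates[j])
  rw [hlen] at h2
  have key1 : (wdepths w C.gates).getD j 0 =
      w (C.gates[j]).fn + univ.sup fun a => wireDepthOf (wdepths w (C.gates.take j)) ((C.gates[j]).args a) := by
    rw [hws, List.getD_eq_getElem?_getD,
      List.getElem?_append_left (by rw [length_wdepths, List.length_append, hlen]; simp),
      ← List.getD_eq_getElem?_getD, h2]
  rw [key1]
  congr 1
  refine Finset.sup_congr rfl fun a _ => ?_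
  have hpre : OutOK (C.gates.take j).length ((C.gates[j]).args a) := fun m' hm' => by
    rw [hlen]; exact C.wf j hj a m' hm'
  have := wireDepthOf_wdepths_append w (C.gates.take j) ([C.gates[j]] ++ C.gates.drop (j + 1)) _ hpre
  rw [← List.append_assoc, hsplit] at this
  exact this.symm

/-- The depth of a wire. [folklore] -/
abbrev wdepth (C : Circuit ι) (u : ι ⊕ ℕ) : ℕ := wireDepthOf (wdepths acWeight C.gates) u

/-- `acDepth` is the depth of the output wire. [folklore] -/
theorem acDepth_eq_wdepth (C : Circuit ι) : C.acDepth = wdepth C C.output :=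
  circuit_depthWith C acWeight

/-- Arguments of a weighted gate are strictly less deep. [folklore] -/
theorem wdepth_args_lt {m : ℕ} (C : Circuit ι) {j : ℕ} (hj : j < C.gates.length)
    (hc : accCode m (C.gates[j]).fn ≠ 0) (a : Fin (C.gates[j]).arity) :
    wdepth C ((C.gates[j]).args a) < wdepth C (.inr j) := by
  unfold wdepth
  rw [wireDepthOf_inr, getD_wdepths_eq acWeight C j hj, acWeight_eq_one_of_accCode_ne hc]
  exact Nat.lt_one_add_iff.2
    (Finset.le_sup (f := fun a => wireDepthOf (wdepths acWeight C.gates) ((C.gates[j]).args a)) (mem_univ a))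

/-- A NOT gate is as deep as its argument. [folklore] -/
theorem wdepth_notGate (C : Circuit ι) {j : ℕ} (hj : j < C.gates.length) {u : ι ⊕ ℕ}
    (hg : C.gates[j] = notGate u) : wdepth C (.inr j) = wdepth C u := by
  unfold wdepth
  rw [wireDepthOf_inr, getD_wdepths_eq acWeight C j hj, hg]
  have h1 : acWeight (notGate u : Gate ι).fn = 0 := by unfold acWeight; exact if_pos rfl
  rw [h1, zero_add]
  show Finset.sup univ (fun _ : Fin 1 => wireDepthOf (wdepths acWeight C.gates) u) = _
  exact Finset.sup_const univ_nonempty _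

/-- Well-formedness at a NOT gate reading a gate. [folklore] -/
theorem lt_of_notGate (C : Circuit ι) {j : ℕ} (hj : j < C.gates.length) {j' : ℕ}
    (hu : C.gates[j] = notGate (.inr j')) : j' < j := by
  have h := C.wf j hj
  rw [hu] at h
  exact h ⟨0, Nat.one_pos⟩ j' rfl

/-! ### Resolving chains of negations -/

/-- The source literal of gate `j`: follow NOT gates down to an input or a non-NOT gate,
recording the parity of the number of negations. [folklore] -/
def srcLit (gs : List (Gate ι)) : ℕ → Bool × (ι ⊕ ℕ)
  | j => match gs[j]? with
    | none => (false, .inr j)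
    | some g =>
      if g.fn = GateFn.not then
        match arg0 g with
        | some (.inl i) => (true, .inl i)
        | some (.inr j') => if j' < j then (!(srcLit gs j').1, (srcLit gs j').2) else (false, .inr j)
        | none => (false, .inr j)
      else (false, .inr j)

/-- Source literal of an index out of range (junk: the index itself). [folklore] -/
theorem srcLit_of_ge {gs : List (Gate ι)} {j : ℕ} (hj : gs.length ≤ j) : srcLit gs j = (false, .inr j) := by
  rw [srcLit, List.getElem?_eq_none hj]

/-- Source literal of a non-NOT gate: the gate itself, positively. [folklore] -/
theorem srcLit_of_not_not {gs : List (Gate ι)} {j : ℕ} (hj : j < gs.length) (h : (gs[j]).fn ≠ GateFn.not) :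
    srcLit gs j = (false, .inr j) := by
  rw [srcLit, List.getElem?_eq_getElem hj]
  simp [h]

/-- Source literal of the negation of an input. [folklore] -/
theorem srcLit_notGate_inl {gs : List (Gate ι)} {j : ℕ} (hj : j < gs.length) {i : ι}
    (h : gs[j] = notGate (.inl i)) : srcLit gs j = (true, .inl i) := by
  rw [srcLit, List.getElem?_eq_getElem hj, h]
  simp only [notGate_fn, if_true, notGate_arg0]

/-- Source literal of the negation of an earlier gate: flip the polarity of its source. [folklore] -/
theorem srcLit_notGate_inr {gs : List (Gate ι)} {j : ℕ} (hj : j < gs.length) {j' : ℕ}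
    (h : gs[j] = notGate (.inr j')) (hj' : j' < j) :
    srcLit gs j = (!(srcLit gs j').1, (srcLit gs j').2) := by
  rw [srcLit, List.getElem?_eq_getElem hj, h]
  simp only [notGate_fn, if_true, notGate_arg0, hj']

/-- Shape of the source: an input, or a non-NOT gate of the program (for `j` in range). [folklore] -/
theorem srcLit_shape (C : Circuit ι) : ∀ j, j < C.gates.length →
    (∃ i, (srcLit C.gates j).2 = .inl i) ∨
    (∃ j', (srcLit C.gates j).2 = .inr j' ∧ ∃ hj' : j' < C.gates.length, (C.gates[j']).fn ≠ GateFn.not ∧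
      wdepth C (.inr j') = wdepth C (.inr j)) := by
  intro j
  induction j using Nat.strong_induction_on with
  | _ j ih =>
    intro hj
    by_cases hn : (C.gates[j]).fn = GateFn.not
    · obtain ⟨u, hu⟩ := exists_eq_notGate_of_fn_eq hn
      cases u with
      | inl i => rw [srcLit_notGate_inl hj hu]; exact Or.inl ⟨i, rfl⟩
      | inr j' =>
        have hj'j : j' < j := lt_of_notGate C hj hu
        rw [srcLit_notGate_inr hj hu hj'j]
        rcases ih j' hj'j (hj'j.trans hj) with ⟨i, hi⟩ | ⟨j'', hj'', hlt, hne, hd⟩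
        · exact Or.inl ⟨i, hi⟩
        · refine Or.inr ⟨j'', hj'', hlt, hne, ?_⟩
          rw [hd, wdepth_notGate C hj hu]
    · rw [srcLit_of_not_not hj hn]
      exact Or.inr ⟨j, rfl, hj, hn, rfl⟩

/-- A valuation of the wires respects negations. [folklore] -/
def NotRespecting (gs : List (Gate ι)) (val : ι ⊕ ℕ → Bool) : Prop :=
  ∀ j (hj : j < gs.length) u, gs[j] = notGate u → val (.inr j) = !val u

/-- Value of a gate = its source literal. [folklore] -/
theorem val_eq_srcLit (C : Circuit ι) {val : ι ⊕ ℕ → Bool} (hval : NotRespecting C.gates val) :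
    ∀ j, val (.inr j) = ((srcLit C.gates j).1 ^^ val (srcLit C.gates j).2) := by
  intro j
  induction j using Nat.strong_induction_on with
  | _ j ih =>
    by_cases hj : j < C.gates.length
    · by_cases hn : (C.gates[j]).fn = GateFn.not
      · obtain ⟨u, hu⟩ := exists_eq_notGate_of_fn_eq hn
        rw [hval j hj u hu]
        cases u with
        | inl i => rw [srcLit_notGate_inl hj hu]; simp
        | inr j' =>
          have hj'j : j' < j := lt_of_notGate C hj hu
          rw [srcLit_notGate_inr hj hu hj'j, ih j' hj'j]
          cases (srcLit C.gates j').1 <;> simp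
      · rw [srcLit_of_not_not hj hn]; simp
    · rw [srcLit_of_ge (not_lt.1 hj)]; simp

/-! ### True values of the wires -/

/-- The value of every wire of `C` at input `x`. [folklore] -/
def tval (C : Circuit ι) (x : ι → Bool) : ι ⊕ ℕ → Bool := wireVal x (transcript x [] C.gates)

/-- The circuit value is the true value of the output wire. [folklore] -/
theorem eval_eq_tval (C : Circuit ι) (x : ι → Bool) : C.eval x = tval C x C.output := eval_eq_wireVal C x

/-- The true value of an input wire. [folklore] -/
@[simp] theorem tval_inl (C : Circuit ι) (x : ι → Bool) (i : ι) : tval C x (.inl i) = x i := rfl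

/-- The gate equation. [folklore] -/
theorem tval_inr (C : Circuit ι) (x : ι → Bool) (j : ℕ) (hj : j < C.gates.length) :
    tval C x (.inr j) = (C.gates[j]).op fun a => tval C x ((C.gates[j]).args a) :=
  getD_transcript_eq_gateValue C x j hj

/-- True values respect negations. [folklore] -/
theorem notRespecting_tval (C : Circuit ι) (x : ι → Bool) : NotRespecting C.gates (tval C x) := by
  intro j hj u hu
  rw [tval_inr C x j hj, hu]
  rfl

/-! ### Randomized gates (Razborov–Smolensky OR via parities of random sub-sums) -/

section rand

variable (m T₀ : ℕ)

/-- The randomized truth table of a gate: AND/OR gates are replaced by the seed-dependent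
parity tests, NOT and MOD gates are kept.
[cite: BeigelTarui1994, Remark 2.4 and Lemma 2.5, Case 2] -/
def rop (β : ℕ → ℕ → ℕ → Bool) (j : ℕ) (g : Gate ι) : (Fin g.arity → Bool) → Bool :=
  if accCode m g.fn = 1 then
    fun v => !decide (∃ t < T₀, Odd #(univ.filter fun a : Fin g.arity => v a = false ∧ β j t a = true))
  else if accCode m g.fn = 2 then
    fun v => decide (∃ t < T₀, Odd #(univ.filter fun a : Fin g.arity => v a = true ∧ β j t a = true))
  else g.op

/-- The randomized gate. [cite: BeigelTarui1994, Lemma 2.5, Case 2] -/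
def rgate (β : ℕ → ℕ → ℕ → Bool) (j : ℕ) (g : Gate ι) : Gate ι := ⟨g.arity, rop m T₀ β j g, g.args⟩

/-- The randomized circuit: same wiring, randomized truth tables.
[cite: BeigelTarui1994, Lemma 2.5] -/
def rand (β : ℕ → ℕ → ℕ → Bool) (C : Circuit ι) : Circuit ι where
  gates := C.gates.mapIdx (rgate m T₀ β)
  output := C.output
  wf := by
    intro j hj
    rw [List.getElem_mapIdx]
    exact fun a m' h => C.wf j (by simpa using hj) a m' h
  wf_output := by
    intro m' hm'
    simpa using C.wf_output m' hm'

variable {m T₀}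

/-- The randomized circuit has the same number of gates. [folklore] -/
@[simp] theorem rand_gates_length (β : ℕ → ℕ → ℕ → Bool) (C : Circuit ι) :
    (rand m T₀ β C).gates.length = C.gates.length := by simp [rand]

/-- The gates of the randomized circuit. [folklore] -/
theorem rand_gates_getElem (β : ℕ → ℕ → ℕ → Bool) (C : Circuit ι) (j : ℕ)
    (hj : j < (rand m T₀ β C).gates.length) :
    (rand m T₀ β C).gates[j] = rgate m T₀ β j (C.gates[j]'(by simpa using hj)) := by
  simp [rand, List.getElem_mapIdx]

/-- The randomized values of the wires. [folklore] -/
def rval (β : ℕ → ℕ → ℕ → Bool) (C : Circuit ι) (x : ι → Bool) : ι ⊕ ℕ → Bool :=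
  tval (rand m T₀ β C) x

/-- The gate equation of the randomized circuit. [folklore] -/
theorem rval_inr (β : ℕ → ℕ → ℕ → Bool) (C : Circuit ι) (x : ι → Bool) (j : ℕ) (hj : j < C.gates.length) :
    rval (m := m) (T₀ := T₀) β C x (.inr j) =
      rop m T₀ β j (C.gates[j]) fun a => rval (m := m) (T₀ := T₀) β C x ((C.gates[j]).args a) := by
  unfold rval
  rw [tval_inr _ x j (by simpa using hj), rand_gates_getElem]
  rfl

/-- NOT gates are not randomized. [folklore] -/
theorem rop_of_accCode_zero {β : ℕ → ℕ → ℕ → Bool} {j : ℕ} {g : Gate ι} (h : accCode m g.fn = 0) :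
    rop m T₀ β j g = g.op := by
  simp [rop, h]

/-- MOD gates are not randomized. [folklore] -/
theorem rop_of_accCode_three {β : ℕ → ℕ → ℕ → Bool} {j : ℕ} {g : Gate ι} (h : accCode m g.fn = 3) :
    rop m T₀ β j g = g.op := by
  simp [rop, h]

/-- The randomized AND gate: no parity test on the false arguments fires. [cite: BeigelTarui1994,
Remark 2.4] -/
theorem rop_of_accCode_one {β : ℕ → ℕ → ℕ → Bool} {j : ℕ} {g : Gate ι} (h : accCode m g.fn = 1) :
    rop m T₀ β j g = fun v =>
      !decide (∃ t < T₀, Odd #(univ.filter fun a : Fin g.arity => v a = false ∧ β j t a = true)) := by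
  simp [rop, h]

/-- The randomized OR gate: some parity test on the true arguments fires (Razborov–Smolensky).
[cite: BeigelTarui1994, Remark 2.4] -/
theorem rop_of_accCode_two {β : ℕ → ℕ → ℕ → Bool} {j : ℕ} {g : Gate ι} (h : accCode m g.fn = 2) :
    rop m T₀ β j g = fun v =>
      decide (∃ t < T₀, Odd #(univ.filter fun a : Fin g.arity => v a = true ∧ β j t a = true)) := by
  simp [rop, h]

/-- Gates other than AND/OR are not randomized. [folklore] -/
theorem rop_of_ne_of_ne {β : ℕ → ℕ → ℕ → Bool} {j : ℕ} {g : Gate ι} (h1 : accCode m g.fn ≠ 1)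
    (h2 : accCode m g.fn ≠ 2) : rop m T₀ β j g = g.op := by
  simp [rop, h1, h2]

/-- Randomized values respect negations. [folklore] -/
theorem notRespecting_rval (β : ℕ → ℕ → ℕ → Bool) (C : Circuit ι) (x : ι → Bool) :
    NotRespecting C.gates (rval (m := m) (T₀ := T₀) β C x) := by
  intro j hj u hu
  rw [rval_inr β C x j hj, hu, rop_of_accCode_zero (by simp)]
  rfl

/-- A seed is good for input `x` if every randomized gate agrees with the original one on the
TRUE values of its arguments. [folklore] -/
def GoodSeed (β : ℕ → ℕ → ℕ → Bool) (C : Circuit ι) (x : ι → Bool) : Prop :=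
  ∀ j (hj : j < C.gates.length), rop m T₀ β j (C.gates[j]) (fun a => tval C x ((C.gates[j]).args a)) =
    (C.gates[j]).op fun a => tval C x ((C.gates[j]).args a)

/-- With a good seed the randomized circuit has the same wire values. [folklore] -/
theorem rval_eq_tval {β : ℕ → ℕ → ℕ → Bool} {C : Circuit ι} {x : ι → Bool}
    (h : GoodSeed (m := m) (T₀ := T₀) β C x) :
    rval (m := m) (T₀ := T₀) β C x = tval C x := by
  unfold rval tval
  congr 1
  symm
  refine eq_transcript_of_gate_equations (rand m T₀ β C) x (transcript x [] C.gates) (by simp [length_transcript]) ?_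
  intro j hj
  rw [rand_gates_getElem]
  have hj' : j < C.gates.length := by simpa using hj
  rw [getD_transcript_eq_gateValue C x j hj']
  exact (h j hj').symm

/-- With a good seed the randomized circuit computes `C` on `x`. [folklore] -/
theorem rand_eval_eq {β : ℕ → ℕ → ℕ → Bool} {C : Circuit ι} {x : ι → Bool}
    (h : GoodSeed (m := m) (T₀ := T₀) β C x) :
    (rand m T₀ β C).eval x = C.eval x := by
  rw [eval_eq_tval, eval_eq_tval]
  exact congrFun (rval_eq_tval h) _

end rand

/-! ### Counting the bad seeds -/

section badcount

variable {m T₀ s : ℕ}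

/-- The finite seed space: a bit for every (gate, trial, argument position). [folklore] -/
abbrev Seed (s₀ T₀ s : ℕ) : Type := Fin s₀ → Fin T₀ → Fin s → Bool

/-- Extension of a finite seed to all indices (by `false`). [folklore] -/
def emb {s₀ T₀ s : ℕ} (ω : Seed s₀ T₀ s) : ℕ → ℕ → ℕ → Bool := fun j t a =>
  if h : j < s₀ ∧ t < T₀ ∧ a < s then ω ⟨j, h.1⟩ ⟨t, h.2.1⟩ ⟨a, h.2.2⟩ else false

/-- The randomized gate disagrees with the original gate on the argument vector `v`. [folklore] -/
def BadOp (m T₀ : ℕ) (β : ℕ → ℕ → ℕ → Bool) (j : ℕ) (g : Gate ι) (v : Fin g.arity → Bool) : Prop :=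
  rop m T₀ β j g v ≠ g.op v

/-- Decidability of `BadOp` (an inequality of Booleans). [folklore] -/
instance (m T₀ : ℕ) (β : ℕ → ℕ → ℕ → Bool) (j : ℕ) (g : Gate ι) (v : Fin g.arity → Bool) :
    Decidable (BadOp m T₀ β j g v) := inferInstanceAs (Decidable (_ ≠ _))

/-- Badness of a seed at a gate of `C` on input `x`: disagreement on the TRUE argument values.
[folklore] -/
def BadAt (m T₀ : ℕ) (C : Circuit ι) (x : ι → Bool) (ω : Seed C.gates.length T₀ s)
    (j : Fin C.gates.length) : Prop :=
  BadOp m T₀ (emb ω) j (C.gates[(j : ℕ)]) fun a => tval C x ((C.gates[(j : ℕ)]).args a)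

/-- Decidability of `BadAt`. [folklore] -/
instance (m T₀ : ℕ) (C : Circuit ι) (x : ι → Bool) (ω : Seed C.gates.length T₀ s) (j : Fin C.gates.length) :
    Decidable (BadAt m T₀ C x ω j) := inferInstanceAs (Decidable (BadOp _ _ _ _ _ _))

/-- A seed that is bad at no gate is good. [folklore] -/
theorem goodSeed_of_not_bad {C : Circuit ι} {x : ι → Bool} {ω : Seed C.gates.length T₀ s}
    (h : ∀ j, ¬ BadAt m T₀ C x ω j) : GoodSeed (m := m) (T₀ := T₀) (emb ω) C x :=
  fun j hj => not_not.1 (h ⟨j, hj⟩)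

/-- At a single gate at most a `2^{-T₀}` fraction of the seeds is bad (for AND/OR gates this is
the isolation bound, other gates are never bad). [cite: BeigelTarui1994, Remark 2.4] -/
theorem card_badOp_le {s₀ : ℕ} (g : Gate ι) (hk : g.arity ≤ s) (v : Fin g.arity → Bool) (j : Fin s₀) :
    2 ^ T₀ * #(univ.filter fun ω : Seed s₀ T₀ s => BadOp m T₀ (emb ω) j g v) ≤
      Fintype.card (Seed s₀ T₀ s) := by
  -- the embedding of argument positions into seed coordinates
  let ιa : Fin g.arity → Fin s := fun a => ⟨a, lt_of_lt_of_le a.2 hk⟩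
  have hιa : Function.Injective ιa := fun a b h => Fin.ext (by simpa [ιa] using congrArg Fin.val h)
  have hemb : ∀ (ω : Seed s₀ T₀ s) (t : ℕ) (ht : t < T₀) (a : Fin g.arity),
      emb ω j t a = ω j ⟨t, ht⟩ (ιa a) := by
    intro ω t ht a
    simp [emb, j.2, ht, lt_of_lt_of_le a.2 hk, ιa]
  have hemb' : ∀ (ω : Seed s₀ T₀ s) (pol : Bool),
      (∃ t < T₀, Odd #(univ.filter fun a : Fin g.arity => v a = pol ∧ emb ω j t a = true)) ↔
      ∃ t : Fin T₀, Odd #(univ.filter fun a : Fin g.arity => v a = pol ∧ ω j t (ιa a) = true) := by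
    intro ω pol
    constructor
    · rintro ⟨t, ht, h⟩
      refine ⟨⟨t, ht⟩, ?_⟩
      simpa [hemb ω t ht] using h
    · rintro ⟨t, h⟩
      refine ⟨t, t.2, ?_⟩
      simpa [hemb ω t t.2] using h
  -- generic bound for a parity event
  have parity_bound : ∀ (pol : Bool), (∃ a₀, v a₀ = pol) →
      2 ^ T₀ * #(univ.filter fun ω : Seed s₀ T₀ s =>
        ∀ t : Fin T₀, Even #(univ.filter fun a : Fin g.arity => v a = pol ∧ ω j t (ιa a) = true)) ≤
      Fintype.card (Seed s₀ T₀ s) := by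
    rintro pol ⟨a₀, ha₀⟩
    refine Derand.card_constrained_mul_le j (fun t (b : Fin s → Bool) =>
      Even #(univ.filter fun a : Fin g.arity => v a = pol ∧ b (ιa a) = true)) fun t => ?_
    have := Derand.two_mul_card_even_count_eq ιa hιa (fun a => decide (v a = pol)) a₀ (by simp [ha₀])
    simp only [decide_eq_true_eq] at this
    rw [this, Fintype.card_fun, Fintype.card_bool, Fintype.card_fin]
  have sub : ∀ pol : Bool, (univ.filter fun ω : Seed s₀ T₀ s =>
        ¬ ∃ t : Fin T₀, Odd #(univ.filter fun a : Fin g.arity => v a = pol ∧ ω j t (ιa a) = true)) ⊆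
      univ.filter fun ω : Seed s₀ T₀ s =>
        ∀ t : Fin T₀, Even #(univ.filter fun a : Fin g.arity => v a = pol ∧ ω j t (ιa a) = true) := by
    intro pol ω hω
    simp only [mem_filter, mem_univ, true_and, not_exists, Nat.not_odd_iff_even] at hω ⊢
    exact hω
  -- case analysis on the gate type
  by_cases h1 : accCode m g.fn = 1
  · by_cases hall : ∀ a, v a = true
    · -- AND of all-true: never bad
      have : (univ.filter fun ω : Seed s₀ T₀ s => BadOp m T₀ (emb ω) j g v) = ∅ := by
        refine filter_eq_empty_iff.2 fun ω _ hbad => hbad ?_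
        rw [op_and_of_accCode h1, rop_of_accCode_one h1]
        simp [hall]
      rw [this]; simp
    · obtain ⟨a₀, ha₀⟩ := not_forall.1 hall
      have ha₀' : v a₀ = false := by simpa using ha₀
      refine le_trans (Nat.mul_le_mul_left _ (card_le_card (Subset.trans ?_ (sub false))))
        (parity_bound false ⟨a₀, ha₀'⟩)
      intro ω hω
      simp only [mem_filter, mem_univ, true_and] at hω ⊢
      unfold BadOp at hω
      rw [op_and_of_accCode h1, rop_of_accCode_one h1] at hω
      have hfalse : decide (∀ i, v i = true) = false := by simpa using ⟨a₀, ha₀'⟩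
      rw [← hemb']
      intro hex
      apply hω
      show (!decide _) = decide (∀ i, v i = true)
      rw [decide_eq_true hex, hfalse]
      rfl
  by_cases h2 : accCode m g.fn = 2
  · by_cases hall : ∀ a, v a = false
    · have : (univ.filter fun ω : Seed s₀ T₀ s => BadOp m T₀ (emb ω) j g v) = ∅ := by
        refine filter_eq_empty_iff.2 fun ω _ hbad => hbad ?_
        rw [op_or_of_accCode h2, rop_of_accCode_two h2]
        simp [hall]
      rw [this]; simp
    · obtain ⟨a₀, ha₀⟩ := not_forall.1 hall
      have ha₀' : v a₀ = true := by simpa using ha₀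
      refine le_trans (Nat.mul_le_mul_left _ (card_le_card (Subset.trans ?_ (sub true))))
        (parity_bound true ⟨a₀, ha₀'⟩)
      intro ω hω
      simp only [mem_filter, mem_univ, true_and] at hω ⊢
      unfold BadOp at hω
      rw [op_or_of_accCode h2, rop_of_accCode_two h2] at hω
      have htrue : decide (∃ i, v i = true) = true := by simpa using ⟨a₀, ha₀'⟩
      rw [← hemb']
      intro hex
      apply hω
      show decide _ = decide (∃ i, v i = true)
      rw [decide_eq_true hex, htrue]
  · -- other gates are not randomized
    have : (univ.filter fun ω : Seed s₀ T₀ s => BadOp m T₀ (emb ω) j g v) = ∅ := by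
      refine filter_eq_empty_iff.2 fun ω _ hbad => hbad ?_
      rw [rop_of_ne_of_ne h1 h2]
    rw [this]; simp

/-- At a single gate of `C`, at most a `2^{-T₀}` fraction of the seeds is bad. [cite:
BeigelTarui1994, Remark 2.4] -/
theorem card_badAt_le (C : Circuit ι) (hfan : C.maxFanIn ≤ s) (x : ι → Bool) (j : Fin C.gates.length) :
    2 ^ T₀ * #(univ.filter fun ω : Seed C.gates.length T₀ s => BadAt m T₀ C x ω j) ≤
      Fintype.card (Seed C.gates.length T₀ s) :=
  card_badOp_le (C.gates[(j : ℕ)]) ((arity_le_maxFanIn C (List.getElem_mem j.2)).trans hfan) _ j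

/-- All seeds bad for `x`: at most an `s · 2^{-T₀}` fraction. [cite: BeigelTarui1994, Lemma 2.5] -/
theorem card_bad_le (C : Circuit ι) (hsize : C.gates.length ≤ s) (hfan : C.maxFanIn ≤ s) (hT₀ : 16 * s ≤ 2 ^ T₀)
    (x : ι → Bool) :
    16 * #(univ.filter fun ω : Seed C.gates.length T₀ s => ∃ j, BadAt m T₀ C x ω j) ≤
      Fintype.card (Seed C.gates.length T₀ s) := by
  have hunion : #(univ.filter fun ω : Seed C.gates.length T₀ s => ∃ j, BadAt m T₀ C x ω j) ≤
      ∑ j : Fin C.gates.length, #(univ.filter fun ω : Seed C.gates.length T₀ s => BadAt m T₀ C x ω j) := by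
    have : (univ.filter fun ω : Seed C.gates.length T₀ s => ∃ j, BadAt m T₀ C x ω j) =
        (univ : Finset (Fin C.gates.length)).biUnion fun j => univ.filter fun ω => BadAt m T₀ C x ω j := by
      ext ω; simp
    rw [this]
    exact card_biUnion_le
  have h2 : 2 ^ T₀ * #(univ.filter fun ω : Seed C.gates.length T₀ s => ∃ j, BadAt m T₀ C x ω j) ≤
      C.gates.length * Fintype.card (Seed C.gates.length T₀ s) := by
    refine (Nat.mul_le_mul_left _ hunion).trans ?_
    rw [mul_sum]
    calc _ ≤ ∑ _j : Fin C.gates.length, Fintype.card (Seed C.gates.length T₀ s) :=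
          sum_le_sum fun j _ => card_badAt_le C hfan x j
      _ = _ := by simp
  by_cases hs : s = 0
  · subst hs
    have h0 : C.gates.length = 0 := Nat.le_zero.1 hsize
    have : (univ.filter fun ω : Seed C.gates.length T₀ 0 => ∃ j, BadAt m T₀ C x ω j) = ∅ := by
      refine filter_eq_empty_iff.2 fun ω _ ⟨j, _⟩ => ?_
      exact absurd j.2 (by omega)
    rw [this]; simp
  · have hspos : 0 < s := Nat.pos_of_ne_zero hs
    have h3 : 16 * s * #(univ.filter fun ω : Seed C.gates.length T₀ s => ∃ j, BadAt m T₀ C x ω j) ≤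
        s * Fintype.card (Seed C.gates.length T₀ s) :=
      calc _ ≤ 2 ^ T₀ * #(univ.filter fun ω : Seed C.gates.length T₀ s => ∃ j, BadAt m T₀ C x ω j) :=
            Nat.mul_le_mul_right _ hT₀
        _ ≤ C.gates.length * Fintype.card (Seed C.gates.length T₀ s) := h2
        _ ≤ s * Fintype.card (Seed C.gates.length T₀ s) := Nat.mul_le_mul_right _ hsize
    rw [Nat.mul_comm 16 s, Nat.mul_assoc] at h3
    exact Nat.le_of_mul_le_mul_left h3 hspos

end badcount

/-! ### Majority of randomized copies -/

section majority

variable {m T₀ s n : ℕ}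

/-- The family of seeds of the copies, extended by the empty seed. [folklore] -/
def seedsOf {s₀ T₀ s T : ℕ} (ωs : Fin T → Seed s₀ T₀ s) (c : ℕ) : ℕ → ℕ → ℕ → Bool :=
  if h : c < T then emb (ωs ⟨c, h⟩) else fun _ _ _ => false

/-- **Derandomized majority** (Beigel–Tarui 1994, Lemma 2.5: "computes `Cₙ` with probability at
least `2/3` ... connect their `S` output gates to a new output gate ... majority"): there are
`T = n + 1` seeds such that on every input the majority of the randomized copies computes
`C`. [cite: BeigelTarui1994, Lemma 2.5] -/
theorem exists_seeds_majority (C : Circuit (Fin n)) (hsize : C.gates.length ≤ s) (hfan : C.maxFanIn ≤ s)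
    (hT₀ : 16 * s ≤ 2 ^ T₀) :
    ∃ ωs : Fin (n + 1) → Seed C.gates.length T₀ s, ∀ x,
      C.eval x = decide (n + 1 < 2 * #(univ.filter fun c : Fin (n + 1) =>
        (rand m T₀ (seedsOf ωs c) C).eval x = true)) := by
  obtain ⟨ωs, hωs⟩ := Derand.exists_majority_good (X := Fin n → Bool) (Ω := Seed C.gates.length T₀ s)
    (fun x ω => ∃ j, BadAt m T₀ C x ω j) (n := n) (T := n + 1) (by simp) (Nat.lt_succ_self n)
    (card_bad_le C hsize hfan hT₀)
  refine ⟨ωs, fun x => ?_⟩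
  set Bd := univ.filter fun c : Fin (n + 1) => ∃ j, BadAt m T₀ C x (ωs c) j with hBd
  have hgood : ∀ c : Fin (n + 1), c ∉ Bd → (rand m T₀ (seedsOf ωs c) C).eval x = C.eval x := by
    intro c hc
    have hseed : seedsOf ωs c = emb (ωs c) := by simp [seedsOf, c.2]
    rw [hseed]
    refine rand_eval_eq (goodSeed_of_not_bad fun j hj => hc ?_)
    simp only [hBd, mem_filter, mem_univ, true_and]
    exact ⟨j, hj⟩
  have hBdlt : 2 * #Bd < n + 1 := hωs x
  set Wn := univ.filter fun c : Fin (n + 1) => (rand m T₀ (seedsOf ωs c) C).eval x = true with hWn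
  cases hCx : C.eval x
  · -- winners ⊆ bad
    have : Wn ⊆ Bd := by
      intro c hc
      by_contra hcB
      have := hgood c hcB
      simp only [hWn, mem_filter, mem_univ, true_and] at hc
      rw [hc, hCx] at this
      exact Bool.noConfusion this
    have := card_le_card this
    symm; simp only [decide_eq_false_iff_not, not_lt]
    omega
  · have : Bdᶜ ⊆ Wn := by
      intro c hc
      rw [mem_compl] at hc
      simp only [hWn, mem_filter, mem_univ, true_and]
      rw [hgood c hc, hCx]
    have h1 := card_le_card this
    rw [card_compl, Fintype.card_fin] at h1
    symm; simp only [decide_eq_true_eq]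
    omega

end majority

end BT


namespace BT

/-! ### Small arithmetic helpers -/

/-- `{0,1}`-valued integer of a Boolean. [folklore] -/
def b2i (b : Bool) : ℤ := if b = true then 1 else 0

/-- `b2i true = 1`. [folklore] -/
@[simp] theorem b2i_true : b2i true = 1 := rfl
/-- `b2i false = 0`. [folklore] -/
@[simp] theorem b2i_false : b2i false = 0 := rfl

/-- `b2i` is `{0,1}`-valued. [folklore] -/
theorem b2i_zero_or_one (b : Bool) : b2i b = 0 ∨ b2i b = 1 := by cases b <;> simp

/-- `|b2i b| ≤ 1`. [folklore] -/
theorem abs_b2i_le (b : Bool) : |b2i b| ≤ 1 := by cases b <;> simp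

/-- `b2i (¬b) = 1 - b2i b`. [folklore] -/
theorem b2i_not (b : Bool) : b2i (!b) = 1 - b2i b := by cases b <;> simp

/-- `b2i` of an exclusive or. [folklore] -/
theorem b2i_xor (a b : Bool) : b2i (a ^^ b) = if a then 1 - b2i b else b2i b := by
  cases a <;> cases b <;> simp

/-- `b2i` of a negated decision. [folklore] -/
theorem b2i_decide_not (P : Prop) [Decidable P] : b2i (decide ¬P) = 1 - b2i (decide P) := by
  by_cases h : P <;> simp [h]

/-- `indNZ p` fixes `{0,1}` for `p ≥ 2`. [folklore] -/
theorem indNZ_b2i {p : ℕ} (hp : 2 ≤ p) (b : Bool) : AForm.indNZ p (b2i b) = b2i b := by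
  cases b
  · simp [AForm.indNZ]
  · simp only [b2i_true, AForm.indNZ]
    rw [if_neg]
    rw [Int.emod_eq_of_lt (by norm_num) (by exact_mod_cast hp)]
    exact one_ne_zero

/-- `indNZ p` only depends on the residue modulo `p`. [folklore] -/
theorem indNZ_congr {p : ℕ} {a b : ℤ} (h : a ≡ b [ZMOD p]) : AForm.indNZ p a = AForm.indNZ p b := by
  unfold AForm.indNZ; rw [h]

/-- `indNZ 2 z = [z odd]`. [folklore] -/
theorem indNZ_two_eq (z : ℤ) : AForm.indNZ 2 z = b2i (decide (Odd z)) := by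
  unfold AForm.indNZ
  by_cases h : z % 2 = 0
  · have : ¬ Odd z := by rw [Int.odd_iff]; omega
    simp [h, this]
  · have : Odd z := by rw [Int.odd_iff]; omega
    simp [h, this]

/-- A product of integers is odd iff all factors are odd. [folklore] -/
theorem odd_list_prod {l : List ℤ} : Odd l.prod ↔ ∀ y ∈ l, Odd y := by
  induction l with
  | nil => simp
  | cons a l ih => simp [Int.odd_mul, ih]

/-- A product of indicators is the indicator of the conjunction. [folklore] -/
theorem list_prod_b2i {α : Type*} (l : List α) (P : α → Prop) [DecidablePred P] :
    (l.map fun a => b2i (decide (P a))).prod = b2i (decide (∀ a ∈ l, P a)) := by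
  induction l with
  | nil => simp
  | cons a l ih =>
    rw [List.map_cons, List.prod_cons, ih]
    by_cases ha : P a <;> by_cases hl : ∀ b ∈ l, P b <;> simp [ha, hl]

/-- Products of termwise congruent lists are congruent. [folklore] -/
theorem list_prod_modEq {α : Type*} {K : ℤ} (l : List α) {f g : α → ℤ} (h : ∀ a ∈ l, f a ≡ g a [ZMOD K]) :
    (l.map f).prod ≡ (l.map g).prod [ZMOD K] := by
  induction l with
  | nil => simp
  | cons a l ih =>
    simp only [List.map_cons, List.prod_cons]
    exact (h a (by simp)).mul (ih fun b hb => h b (by simp [hb]))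

/-- A sum of indicators counts. [folklore] -/
theorem sum_b2i_eq_card {α : Type*} (s : Finset α) (P : α → Prop) [DecidablePred P] :
    ∑ a ∈ s, b2i (decide (P a)) = #(s.filter P) := by
  rw [Finset.card_filter, Nat.cast_sum]
  refine Finset.sum_congr rfl fun a _ => ?_
  by_cases h : P a <;> simp [h]

/-! ### Number theory: `MOD_{p^e}` through binomial coefficients (Beigel–Tarui 1994, Fact 2.2) -/

/-- Lucas' theorem, digit form: `C(N, p^i) ≡ ⌊N/p^i⌋ (mod p)` (the same statement, with the
same proof from Mathlib's `Choose.choose_modEq_choose_mod_mul_choose_div_nat`, is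
`Literature.Barriers.PneNP.choose_pow_prime_mod` in `Literature/Barriers/PneNP/CompositeModulusDegree.lean`,
a barrier entry importing all of Mathlib, deliberately not imported here). [cite: BeigelTarui1994, Fact 2.2] -/
theorem choose_pow_prime_mod {p : ℕ} [hp : Fact p.Prime] (w i : ℕ) :
    w.choose (p ^ i) ≡ w / p ^ i % p [MOD p] := by
  induction i generalizing w with
  | zero => simpa using (Nat.mod_modEq w p).symm
  | succ i ih =>
    have h1 := Choose.choose_modEq_choose_mod_mul_choose_div_nat (n := w) (k := p ^ (i + 1)) (p := p)
    have hmod : p ^ (i + 1) % p = 0 := by rw [pow_succ, Nat.mul_mod_left]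
    have hdiv : p ^ (i + 1) / p = p ^ i := by rw [pow_succ, Nat.mul_div_cancel _ hp.out.pos]
    rw [hmod, hdiv, Nat.choose_zero_right, one_mul] at h1
    refine h1.trans ?_
    have h2 := ih (w / p)
    rw [Nat.div_div_eq_div_mul, mul_comm, ← pow_succ] at h2
    exact h2

/-- Base-`p` digits: `p^e ∣ N` iff the `e` lowest digits of `N` vanish. [folklore] -/
theorem pow_dvd_iff_digits {p : ℕ} (hp : 0 < p) : ∀ e N : ℕ, p ^ e ∣ N ↔ ∀ i < e, N / p ^ i % p = 0 := by
  intro e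
  induction e with
  | zero => intro N; simp
  | succ e ih =>
    intro N
    constructor
    · rintro ⟨q, rfl⟩ i hi
      have hsplit : p ^ (e + 1) * q = p ^ i * (p ^ (e + 1 - i) * q) := by
        rw [← mul_assoc, ← pow_add, Nat.add_sub_cancel' (le_of_lt hi)]
      rw [hsplit, Nat.mul_div_cancel_left _ (Nat.pow_pos hp)]
      exact (Nat.dvd_iff_mod_eq_zero).1 (Dvd.dvd.mul_right (dvd_pow_self p (by omega)) q)
    · intro h
      have h0 : N % p = 0 := by simpa using h 0 (Nat.succ_pos e)
      obtain ⟨N', rfl⟩ := Nat.dvd_of_mod_eq_zero h0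
      have hN' : p ^ e ∣ N' := by
        refine (ih N').2 fun i hi => ?_
        have := h (i + 1) (Nat.succ_lt_succ hi)
        rwa [pow_succ', ← Nat.div_div_eq_div_mul, Nat.mul_div_cancel_left _ hp] at this
      rw [pow_succ']
      exact Nat.mul_dvd_mul_left p hN'

/-- **Beigel–Tarui's Fact 2.2**: `p^e ∣ N` iff `p ∣ C(N, p^i)` for all `i < e`. [cite:
BeigelTarui1994, Fact 2.2] -/
theorem pow_dvd_iff_forall_dvd_choose {p : ℕ} (hp : p.Prime) (e N : ℕ) :
    p ^ e ∣ N ↔ ∀ i < e, p ∣ N.choose (p ^ i) := by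
  haveI := Fact.mk hp
  have key : ∀ i, p ∣ N.choose (p ^ i) ↔ N / p ^ i % p = 0 := by
    intro i
    rw [Nat.dvd_iff_mod_eq_zero, (choose_pow_prime_mod (p := p) N i)]
    constructor
    · intro h; simpa [Nat.mod_mod] using h
    · intro h; simp [h]
  simp_rw [key]
  exact pow_dvd_iff_digits hp.pos e N

/-- `m ∣ N` iff every maximal prime power of `m` divides `N`. [folklore] -/
theorem dvd_iff_forall_primeFactors {m : ℕ} (hm : m ≠ 0) (N : ℕ) :
    m ∣ N ↔ ∀ p ∈ m.primeFactors, p ^ m.factorization p ∣ N := by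
  constructor
  · intro h p _
    exact (Nat.ordProj_dvd m p).trans h
  · intro h
    rw [Nat.dvd_iff_prime_pow_dvd_dvd]
    intro p k hp hpk
    rcases Nat.eq_zero_or_pos k with rfl | hk
    · simp
    · have hpm : p ∣ m := (dvd_pow_self p hk.ne').trans hpk
      have hmem : p ∈ m.primeFactors := Nat.mem_primeFactors.2 ⟨hp, hpm, hm⟩
      have hkle : k ≤ m.factorization p := (hp.pow_dvd_iff_le_factorization hm).1 hpk
      exact (pow_dvd_pow p hkle).trans (h p hmem)

/-! ### The setup: circuit, modulus, seeds -/

/-- The data of the construction: the modulus `m`, the number `T₀` of isolation trials per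
OR/AND gate, the circuit `C` over `accBasis m`, and the seeds of all copies.
[cite: BeigelTarui1994, Lemma 2.5] -/
structure Setup (n : ℕ) where
  /-- The modulus of the MOD gates. -/
  m : ℕ
  /-- Number of parity trials per AND/OR gate. -/
  T₀ : ℕ
  /-- The circuit. -/
  C : Circuit (Fin n)
  /-- The seed of copy `c`. -/
  βs : ℕ → ℕ → ℕ → ℕ → Bool
  two_le_m : 2 ≤ m
  isOver : C.IsOver (accBasis m)

/-- The variables of the collapse: inputs `inl i`, gate `j` of copy `c` as `inr (c, j, 0)`, and
the auxiliary `MOD_{p^e}` value of gate `j` of copy `c` for the prime `p ∣ m` as `inr (c, j, p)`.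
[cite: BeigelTarui1994, Lemma 2.5, Cases 1–2] -/
abbrev V (n : ℕ) : Type := Fin n ⊕ (ℕ × ℕ × ℕ)

namespace Setup

variable {n : ℕ} (K : Setup n)

/-- The symbolic code of gate `j` (`4` out of range). [folklore] -/
def code (j : ℕ) : ℕ := if h : j < K.C.gates.length then accCode K.m (K.C.gates[j]).fn else 4

/-- The code of a gate in range. [folklore] -/
theorem code_eq {j : ℕ} (hj : j < K.C.gates.length) : K.code j = accCode K.m (K.C.gates[j]).fn := by
  simp [code, hj]

/-- Codes of the gates of a circuit over `accBasis m` are `≤ 3`. [folklore] -/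
theorem code_le_three {j : ℕ} (hj : j < K.C.gates.length) : K.code j ≤ 3 := by
  rw [K.code_eq hj]
  exact accCode_le_three (K.isOver _ (List.getElem_mem hj))

/-- `m ≠ 0`. [folklore] -/
theorem m_ne_zero : K.m ≠ 0 := by have := K.two_le_m; omega

/-- The randomized wire values of copy `c`. [folklore] -/
def rv (c : ℕ) (x : Fin n → Bool) : Fin n ⊕ ℕ → Bool := rval (m := K.m) (T₀ := K.T₀) (K.βs c) K.C x

/-- The number of true argument wires of gate `j` in copy `c`. [folklore] -/
def cnt (c j : ℕ) (x : Fin n → Bool) : ℕ :=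
  if hj : j < K.C.gates.length then
    #(univ.filter fun a : Fin (K.C.gates[j]).arity => K.rv c x ((K.C.gates[j]).args a) = true)
  else 0

/-- The valuation of all variables at input `x` (values in `{0,1}`).
[cite: BeigelTarui1994, Lemma 2.5] -/
def val (x : Fin n → Bool) : V n → ℤ
  | .inl i => b2i (x i)
  | .inr (c, j, 0) => b2i (K.rv c x (.inr j))
  | .inr (c, j, p + 1) => b2i (decide (¬ (p + 1) ^ K.m.factorization (p + 1) ∣ K.cnt c j x))

/-- The valuation is `{0,1}`-valued. [folklore] -/
theorem val_zero_or_one (x : Fin n → Bool) : ∀ v, K.val x v = 0 ∨ K.val x v = 1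
  | .inl _ => b2i_zero_or_one _
  | .inr (_, _, 0) => b2i_zero_or_one _
  | .inr (_, _, _ + 1) => b2i_zero_or_one _

/-- `|val x v| ≤ 1`. [folklore] -/
theorem abs_val_le (x : Fin n → Bool) (v : V n) : |K.val x v| ≤ 1 := by
  rcases K.val_zero_or_one x v with h | h <;> simp [h]

/-- The value of an auxiliary variable: `[p^{ν_p(m)} ∤ cnt]`. [folklore] -/
theorem val_aux (x : Fin n → Bool) (c j : ℕ) {p : ℕ} (hp : 0 < p) :
    K.val x (.inr (c, j, p)) = b2i (decide (¬ p ^ K.m.factorization p ∣ K.cnt c j x)) := by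
  obtain ⟨p, rfl⟩ : ∃ q, p = q + 1 := ⟨p - 1, by omega⟩
  rfl

/-! ### Literals -/

/-- A formula with the polarity `b` applied. [folklore] -/
def polF {σ : Type*} : Bool → AForm σ → AForm σ
  | false, F => F
  | true, F => F.oneSub

/-- The variable of a source wire in copy `c`. [folklore] -/
def baseF (c : ℕ) : Fin n ⊕ ℕ → AForm (V n)
  | .inl i => AForm.var (.inl i)
  | .inr j => AForm.var (.inr (c, j, 0))

/-- The literal formula of the wire `w` of copy `c`: negation chains are resolved to the source.
[folklore] -/
def litF (c : ℕ) : Fin n ⊕ ℕ → AForm (V n)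
  | .inl i => AForm.var (.inl i)
  | .inr j => polF (srcLit K.C.gates j).1 (baseF c (srcLit K.C.gates j).2)

/-- Value of the base variable of a wire. [folklore] -/
theorem eval_baseF (c : ℕ) (x : Fin n → Bool) (w : Fin n ⊕ ℕ) :
    (baseF c w).eval (K.val x) = b2i (K.rv c x w) := by
  cases w with
  | inl i => rfl
  | inr j => rfl

/-- Value of a polarized formula. [folklore] -/
theorem eval_polF {σ : Type*} (b : Bool) (F : AForm σ) (ν : σ → ℤ) :
    (polF b F).eval ν = if b then 1 - F.eval ν else F.eval ν := by
  cases b <;> simp [polF]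

/-- The literal formula computes the (randomized) value of the wire. [folklore] -/
theorem eval_litF (c : ℕ) (x : Fin n → Bool) (w : Fin n ⊕ ℕ) :
    (K.litF c w).eval (K.val x) = b2i (K.rv c x w) := by
  cases w with
  | inl i => rfl
  | inr j =>
    simp only [litF, eval_polF, eval_baseF]
    rw [show K.rv c x (.inr j) = _ from val_eq_srcLit K.C (notRespecting_rval (K.βs c) K.C x) j, b2i_xor]
    rfl

/-- Degree of a polarized formula. [folklore] -/
theorem deg_polF_le {σ : Type*} (b : Bool) (F : AForm σ) : (polF b F).deg = F.deg := by
  cases b <;> simp [polF]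

/-- Weight of a polarized formula. [folklore] -/
theorem wt_polF_le {σ : Type*} (b : Bool) (F : AForm σ) : (polF b F).wt ≤ F.wt + 1 := by
  cases b <;> simp [polF]

/-- Literals have degree `1`. [folklore] -/
theorem deg_litF (c : ℕ) (w : Fin n ⊕ ℕ) : (K.litF c w).deg = 1 := by
  cases w with
  | inl i => rfl
  | inr j => simp only [litF, deg_polF_le]; cases (srcLit K.C.gates j).2 <;> rfl

/-- Literals have weight `≤ 2`. [folklore] -/
theorem wt_litF_le (c : ℕ) (w : Fin n ⊕ ℕ) : (K.litF c w).wt ≤ 2 := by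
  cases w with
  | inl i => exact Nat.le_succ 1
  | inr j =>
    simp only [litF]
    refine (wt_polF_le _ _).trans ?_
    cases (srcLit K.C.gates j).2 <;> exact le_rfl

/-- The variables a literal of copy `c` may mention: inputs, and non-NOT gates of copy `c` of the
same depth as the wire. [folklore] -/
def LitVars (c : ℕ) (w : Fin n ⊕ ℕ) (v : V n) : Prop :=
  (∃ i, v = .inl i) ∨ ∃ j', v = .inr (c, j', 0) ∧ j' < K.C.gates.length ∧ K.code j' ≠ 0 ∧
    wdepth K.C (.inr j') = wdepth K.C w

/-- The variables of a literal (`LitVars`): inputs, or a non-NOT gate of the same copy and the same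
depth as the wire. [folklore] -/
theorem varsIn_litF (c : ℕ) (w : Fin n ⊕ ℕ) (hw : OutOK K.C.gates.length w) :
    (K.litF c w).VarsIn (K.LitVars c w) := by
  cases w with
  | inl i => exact Or.inl ⟨i, rfl⟩
  | inr j =>
    have hj : j < K.C.gates.length := hw j rfl
    simp only [litF]
    have base : ∀ b (F : AForm (V n)) (P : V n → Prop), F.VarsIn P → (polF b F).VarsIn P := by
      intro b F P h; cases b
      · exact h
      · exact h.oneSub
    apply base
    rcases srcLit_shape K.C j hj with ⟨i, hi⟩ | ⟨j', hj', hlt, hne, hd⟩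
    · rw [hi]; exact Or.inl ⟨i, rfl⟩
    · rw [hj']
      refine Or.inr ⟨j', rfl, hlt, ?_, hd⟩
      rw [K.code_eq hlt]
      intro h0
      exact hne (fn_eq_not_of_accCode h0)

/-! ### The gate polynomials -/

section gates

variable (c j : ℕ) (g : Gate (Fin n))

/-- The positions selected by trial `t` of the seed of gate `j` in copy `c`.
[cite: BeigelTarui1994, Remark 2.4] -/
def sel (t : ℕ) : Finset (Fin g.arity) := univ.filter fun a => K.βs c j t a = true

/-- AND gate: `∏_t (1 - ∑_{a ∈ sel t} (1 - ℓ_a))` (parity tests on the negated inputs).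
[cite: BeigelTarui1994, Lemma 2.5, Case 2] -/
noncomputable def andF : AForm (V n) :=
  AForm.prodL ((List.range K.T₀).map fun t =>
    (AForm.sumL (((K.sel c j g t).toList).map fun a => (K.litF c (g.args a)).oneSub)).oneSub)

/-- OR gate: `1 - ∏_t (1 - ∑_{a ∈ sel t} ℓ_a)` (Razborov–Smolensky).
[cite: BeigelTarui1994, Lemma 2.5, Case 2] -/
noncomputable def orF : AForm (V n) :=
  (AForm.prodL ((List.range K.T₀).map fun t =>
    (AForm.sumL (((K.sel c j g t).toList).map fun a => K.litF c (g.args a))).oneSub)).oneSub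

/-- MOD gate: `1 - ∏_{p ∣ m} (1 - u_p)` over the auxiliary `MOD_{p^e}` variables.
[cite: BeigelTarui1994, Lemma 2.5, Case 1] -/
noncomputable def modF : AForm (V n) :=
  (AForm.prodL (K.m.primeFactors.toList.map fun p => (AForm.var (.inr (c, j, p))).oneSub)).oneSub

/-- Elementary symmetric polynomial of degree `q` in the argument literals.
[cite: BeigelTarui1994, Lemma 2.1] -/
noncomputable def esymF (q : ℕ) : AForm (V n) :=
  AForm.sumL (((univ : Finset (Fin g.arity)).powersetCard q).toList.map fun A =>
    AForm.prodL (A.toList.map fun a => K.litF c (g.args a)))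

/-- Auxiliary `MOD_{p^e}` polynomial `1 - ∏_{t<e} (1 - e_{p^t}^{p-1})` (Beigel–Tarui 1994,
Lemma 2.1). [cite: BeigelTarui1994, Lemma 2.1] -/
noncomputable def auxF (p : ℕ) : AForm (V n) :=
  (AForm.prodL ((List.range (K.m.factorization p)).map fun t =>
    ((K.esymF c g (p ^ t)).pow (p - 1)).oneSub)).oneSub

end gates

/-- The polynomial of gate `j` of copy `c` (prime `2`). [cite: BeigelTarui1994, Lemma 2.5] -/
noncomputable def gateF (c j : ℕ) : AForm (V n) :=
  if hj : j < K.C.gates.length then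
    if accCode K.m (K.C.gates[j]).fn = 1 then K.andF c j (K.C.gates[j])
    else if accCode K.m (K.C.gates[j]).fn = 2 then K.orF c j (K.C.gates[j])
    else K.modF c j
  else AForm.cst 0

/-- The auxiliary polynomial of gate `j` of copy `c` for the prime `p`.
[cite: BeigelTarui1994, Lemma 2.1] -/
noncomputable def auxFj (c j p : ℕ) : AForm (V n) :=
  if hj : j < K.C.gates.length then K.auxF c (K.C.gates[j]) p else AForm.cst 0

/-! #### Semantics of the gate polynomials -/

/-- A list sum over `s.toList` is a `Finset` sum. [folklore] -/
theorem eval_sumL_toList {α σ : Type*} (s : Finset α) (f : α → AForm σ) (ν : σ → ℤ) :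
    (AForm.sumL (s.toList.map f)).eval ν = ∑ a ∈ s, (f a).eval ν := by
  rw [AForm.eval_sumL, List.map_map]
  exact Finset.sum_map_toList s _

/-- A list product over `s.toList` is a `Finset` product. [folklore] -/
theorem eval_prodL_toList {α σ : Type*} (s : Finset α) (f : α → AForm σ) (ν : σ → ℤ) :
    (AForm.prodL (s.toList.map f)).eval ν = ∏ a ∈ s, (f a).eval ν := by
  rw [AForm.eval_prodL, List.map_map]
  exact Finset.prod_map_toList s _

/-- `e_q` at the argument literals counts the `q`-subsets of the true arguments. [cite:
BeigelTarui1994, Lemma 2.1] -/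
theorem eval_esymF (c : ℕ) (g : Gate (Fin n)) (q : ℕ) (x : Fin n → Bool) :
    (K.esymF c g q).eval (K.val x) =
      ((#(univ.filter fun a : Fin g.arity => K.rv c x (g.args a) = true)).choose q : ℕ) := by
  unfold esymF
  rw [eval_sumL_toList]
  have hprod : ∀ A : Finset (Fin g.arity),
      (AForm.prodL (A.toList.map fun a => K.litF c (g.args a))).eval (K.val x) =
        if ∀ a ∈ A, K.rv c x (g.args a) = true then 1 else 0 := by
    intro A
    rw [eval_prodL_toList]
    simp_rw [eval_litF]
    split_ifs with h
    · exact Finset.prod_eq_one fun a ha => by rw [h a ha]; rfl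
    · obtain ⟨a, ha, hfa⟩ : ∃ a ∈ A, K.rv c x (g.args a) ≠ true := by simpa using h
      exact Finset.prod_eq_zero ha (by rw [Bool.eq_false_iff.2 hfa]; rfl)
  simp_rw [hprod]
  rw [Finset.sum_boole]
  congr 1
  rw [← card_powersetCard]
  congr 1
  ext A
  simp only [mem_filter, mem_powersetCard, subset_univ, true_and]
  constructor
  · rintro ⟨hcard, hall⟩
    exact ⟨fun a ha => mem_filter.2 ⟨mem_univ _, hall a ha⟩, hcard⟩
  · rintro ⟨hsub, hcard⟩
    exact ⟨hcard, fun a ha => (mem_filter.1 (hsub ha)).2⟩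


/-! #### The modular gate equations -/

/-- `1 - b2i b = b2i (b = false)`. [folklore] -/
theorem one_sub_b2i (b : Bool) : 1 - b2i b = b2i (decide (b = false)) := by cases b <;> simp

/-- `1 - z` is odd iff `z` is even. [folklore] -/
theorem odd_one_sub (z : ℤ) : Odd (1 - z) ↔ Even z := by
  rw [Int.odd_sub]
  exact ⟨fun h => h.1 odd_one, fun h => ⟨fun _ => h, fun _ => odd_one⟩⟩

/-- `indNZ p c = [p ∤ c]` for a natural number `c`. [folklore] -/
theorem indNZ_natCast (p c : ℕ) : AForm.indNZ p (c : ℤ) = b2i (decide (¬ p ∣ c)) := by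
  unfold AForm.indNZ
  have key : ((c : ℤ) % (p : ℤ) = 0) ↔ p ∣ c := by
    rw [← Int.natCast_mod, Int.natCast_eq_zero, Nat.dvd_iff_mod_eq_zero]
  by_cases h : p ∣ c
  · rw [if_pos (key.2 h)]; simp [h]
  · rw [if_neg (fun h' => h (key.1 h'))]; simp [h]

/-- **Gate equation, prime `2`**: the value of a (non-NOT) gate of copy `c` is
`[gateF ≢ 0 (mod 2)]` — exact for MOD gates, and by construction for the randomized AND/OR
gates (Beigel–Tarui 1994, Lemma 2.5, Cases 1–2). [cite: BeigelTarui1994, Lemma 2.5] -/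
theorem val_gate_eq (x : Fin n → Bool) (c j : ℕ) (hj : j < K.C.gates.length)
    (h0 : accCode K.m (K.C.gates[j]).fn ≠ 0) :
    K.val x (.inr (c, j, 0)) = AForm.indNZ 2 ((K.gateF c j).eval (K.val x)) := by
  have h3 : accCode K.m (K.C.gates[j]).fn ≤ 3 := accCode_le_three (K.isOver _ (List.getElem_mem hj))
  show b2i (K.rv c x (.inr j)) = _
  have hrv : K.rv c x (.inr j) = rop K.m K.T₀ (K.βs c) j (K.C.gates[j]) fun a => K.rv c x ((K.C.gates[j]).args a) :=
    rval_inr (K.βs c) K.C x j hj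
  rw [hrv]
  unfold gateF
  rw [dif_pos hj]
  set g := K.C.gates[j] with hg
  set v : Fin g.arity → Bool := fun a => K.rv c x (g.args a) with hv
  -- the parity sums
  have hsumF : ∀ t, (AForm.sumL ((K.sel c j g t).toList.map fun a => (K.litF c (g.args a)).oneSub)).eval (K.val x) =
      (#(univ.filter fun a : Fin g.arity => v a = false ∧ K.βs c j t a = true) : ℤ) := by
    intro t
    rw [eval_sumL_toList]
    simp_rw [AForm.eval_oneSub, eval_litF, one_sub_b2i]
    rw [sum_b2i_eq_card, sel, filter_filter]
    congr 2; ext a; simp [hv, and_comm]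
  have hsumT : ∀ t, (AForm.sumL ((K.sel c j g t).toList.map fun a => K.litF c (g.args a))).eval (K.val x) =
      (#(univ.filter fun a : Fin g.arity => v a = true ∧ K.βs c j t a = true) : ℤ) := by
    intro t
    rw [eval_sumL_toList]
    simp_rw [eval_litF]
    have : ∀ a, b2i (K.rv c x (g.args a)) = b2i (decide (v a = true)) := fun a => by simp [hv]
    simp_rw [this]
    rw [sum_b2i_eq_card, sel, filter_filter]
    congr 2; ext a; simp [and_comm]
  by_cases h1 : accCode K.m g.fn = 1
  · rw [if_pos h1, rop_of_accCode_one h1, indNZ_two_eq]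
    simp only [andF, AForm.eval_prodL, List.map_map]
    congr 1
    rw [Bool.eq_iff_iff]
    simp only [Bool.not_eq_true', decide_eq_false_iff_not, decide_eq_true_eq, not_exists, not_and,
      Nat.not_odd_iff_even]
    rw [odd_list_prod]
    simp only [List.mem_map, List.mem_range, forall_exists_index, and_imp,
      forall_apply_eq_imp_iff₂, Function.comp_apply, AForm.eval_oneSub, hsumF, odd_one_sub,
      Int.even_coe_nat]
  by_cases h2 : accCode K.m g.fn = 2
  · rw [if_neg h1, if_pos h2, rop_of_accCode_two h2, indNZ_two_eq]
    simp only [orF, AForm.eval_oneSub, AForm.eval_prodL, List.map_map]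
    congr 1
    rw [Bool.eq_iff_iff]
    simp only [decide_eq_true_eq]
    rw [odd_one_sub, ← Int.not_odd_iff_even, odd_list_prod]
    simp only [List.mem_map, List.mem_range, forall_exists_index, and_imp, forall_apply_eq_imp_iff₂,
      Function.comp_apply, AForm.eval_oneSub, hsumT, odd_one_sub, Int.even_coe_nat, not_forall,
      Nat.not_even_iff_odd, exists_prop]
  -- MOD gate
  have h3' : accCode K.m g.fn = 3 := by omega
  rw [if_neg h1, if_neg h2, rop_of_accCode_three h3', op_mod_of_accCode h3']
  simp only [modF, AForm.eval_oneSub, AForm.eval_prodL, List.map_map, Function.comp_def, AForm.eval]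
  have hp : ∀ p ∈ K.m.primeFactors.toList, (1 : ℤ) - K.val x (.inr (c, j, p)) =
      b2i (decide (p ^ K.m.factorization p ∣ K.cnt c j x)) := by
    intro p hp
    rw [Finset.mem_toList] at hp
    rw [K.val_aux x c j (Nat.prime_of_mem_primeFactors hp).pos, ← b2i_decide_not]
    simp only [not_not]
  rw [List.map_congr_left hp, list_prod_b2i]
  have hcnt : GateFn.numOnes v = K.cnt c j x := by
    simp only [GateFn.numOnes, cnt, dif_pos hj]
    rfl
  rw [hcnt, one_sub_b2i]
  have hiff : (decide (∀ a ∈ K.m.primeFactors.toList, a ^ K.m.factorization a ∣ K.cnt c j x) = false) ↔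
      K.cnt c j x % K.m ≠ 0 := by
    rw [decide_eq_false_iff_not]
    simp only [Finset.mem_toList]
    rw [← dvd_iff_forall_primeFactors K.m_ne_zero, Nat.dvd_iff_mod_eq_zero]
  rw [indNZ_b2i le_rfl]
  congr 1
  exact decide_eq_decide.2 hiff.symm

/-- **Auxiliary equation, prime `p ∣ m`**: the `MOD_{p^e}` value of a gate is
`[auxF ≢ 0 (mod p)]` (Beigel–Tarui 1994, Lemma 2.1 with Fact 2.2 and Fermat's little
theorem). [cite: BeigelTarui1994, Lemma 2.1] -/
theorem val_aux_eq (x : Fin n → Bool) (c j : ℕ) (hj : j < K.C.gates.length) {p : ℕ}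
    (hp : p ∈ K.m.primeFactors) :
    K.val x (.inr (c, j, p)) = AForm.indNZ p ((K.auxFj c j p).eval (K.val x)) := by
  have hpp : p.Prime := Nat.prime_of_mem_primeFactors hp
  unfold auxFj
  rw [dif_pos hj, K.val_aux x c j hpp.pos]
  set g := K.C.gates[j] with hg
  set e := K.m.factorization p with he
  set N := K.cnt c j x with hN
  have hNdef : N = #(univ.filter fun a : Fin g.arity => K.rv c x (g.args a) = true) := by
    simp only [hN, cnt, dif_pos hj]; rfl
  -- the auxiliary polynomial modulo p
  have hmod : (K.auxF c g p).eval (K.val x) ≡ b2i (decide (¬ p ^ e ∣ N)) [ZMOD p] := by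
    simp only [auxF, AForm.eval_oneSub, AForm.eval_prodL, List.map_map, Function.comp_def, AForm.eval_pow,
      eval_esymF, ← hNdef]
    have step : ((List.range e).map fun t => (1 : ℤ) - ((N.choose (p ^ t) : ℕ) : ℤ) ^ (p - 1)).prod ≡
        ((List.range e).map fun t => b2i (decide (p ∣ N.choose (p ^ t)))).prod [ZMOD p] := by
      refine list_prod_modEq _ fun t _ => ?_
      refine ((Int.ModEq.refl 1).sub (AForm.pow_pred_modEq_indNZ hpp _)).trans ?_
      rw [indNZ_natCast, b2i_decide_not, sub_sub_cancel]
    refine ((Int.ModEq.refl 1).sub step).trans ?_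
    rw [list_prod_b2i, b2i_decide_not]
    simp only [List.mem_range]
    rw [show decide (∀ t < e, p ∣ N.choose (p ^ t)) = decide (p ^ e ∣ N) from
      decide_eq_decide.2 (pow_dvd_iff_forall_dvd_choose hpp e N).symm]
  rw [indNZ_congr hmod, indNZ_b2i hpp.two_le]

/-! #### Degree, weight and variables of the gate polynomials -/

/-- `m` has at most `m + 1` prime factors (a crude bound). [folklore] -/
theorem length_primeFactors_toList_le (m : ℕ) : m.primeFactors.toList.length ≤ m + 1 := by
  rw [Finset.length_toList]
  calc #m.primeFactors ≤ #(Finset.range (m + 1)) := card_le_card fun p hp => by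
        rw [Finset.mem_range]; exact Nat.lt_succ_of_le (Nat.le_of_mem_primeFactors hp)
    _ = m + 1 := Finset.card_range _

section bounds

variable (c j : ℕ) (g : Gate (Fin n))

/-- Degree of the AND polynomial: `≤ T₀`. [cite: BeigelTarui1994, Lemma 2.5] -/
theorem deg_andF_le : (K.andF c j g).deg ≤ K.T₀ := by
  unfold andF
  refine (AForm.deg_prodL_le (D := 1) fun F hF => ?_).trans (by simp)
  simp only [List.mem_map, List.mem_range] at hF
  obtain ⟨t, -, rfl⟩ := hF
  rw [AForm.deg_oneSub]
  refine AForm.deg_sumL_le fun G hG => ?_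
  simp only [List.mem_map, Finset.mem_toList] at hG
  obtain ⟨a, -, rfl⟩ := hG
  rw [AForm.deg_oneSub, deg_litF]

/-- Degree of the OR polynomial: `≤ T₀`. [cite: BeigelTarui1994, Lemma 2.5] -/
theorem deg_orF_le : (K.orF c j g).deg ≤ K.T₀ := by
  unfold orF
  rw [AForm.deg_oneSub]
  refine (AForm.deg_prodL_le (D := 1) fun F hF => ?_).trans (by simp)
  simp only [List.mem_map, List.mem_range] at hF
  obtain ⟨t, -, rfl⟩ := hF
  rw [AForm.deg_oneSub]
  refine AForm.deg_sumL_le fun G hG => ?_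
  simp only [List.mem_map, Finset.mem_toList] at hG
  obtain ⟨a, -, rfl⟩ := hG
  rw [deg_litF]

/-- Degree of the MOD polynomial: `≤ m + 1`. [cite: BeigelTarui1994, Lemma 2.5] -/
theorem deg_modF_le : (K.modF c j).deg ≤ K.m + 1 := by
  unfold modF
  rw [AForm.deg_oneSub]
  refine (AForm.deg_prodL_le (D := 1) fun F hF => ?_).trans ?_
  · simp only [List.mem_map] at hF
    obtain ⟨p, -, rfl⟩ := hF
    rfl
  · simpa using length_primeFactors_toList_le K.m

/-- Degree of `e_q`: `≤ q`. [cite: BeigelTarui1994, Lemma 2.1] -/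
theorem deg_esymF_le (q : ℕ) : (K.esymF c g q).deg ≤ q := by
  unfold esymF
  refine AForm.deg_sumL_le fun F hF => ?_
  simp only [List.mem_map, Finset.mem_toList, mem_powersetCard] at hF
  obtain ⟨A, ⟨-, hA⟩, rfl⟩ := hF
  refine (AForm.deg_prodL_le (D := 1) fun G hG => ?_).trans ?_
  · simp only [List.mem_map, Finset.mem_toList] at hG
    obtain ⟨a, -, rfl⟩ := hG
    rw [deg_litF]
  · simp [Finset.length_toList, hA]

/-- `p^t ≤ m` for `t ≤ ν_p(m)`. [folklore] -/
theorem pow_factorization_le {p : ℕ} (hp : p ∈ K.m.primeFactors) {t : ℕ} (ht : t ≤ K.m.factorization p) :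
    p ^ t ≤ K.m :=
  (Nat.pow_le_pow_right (Nat.prime_of_mem_primeFactors hp).pos ht).trans
    (Nat.le_of_dvd (Nat.pos_of_ne_zero K.m_ne_zero) (Nat.ordProj_dvd K.m p))

/-- Degree of the auxiliary `MOD_{p^e}` polynomial: `≤ m³`. [cite: BeigelTarui1994, Lemma 2.1] -/
theorem deg_auxF_le {p : ℕ} (hp : p ∈ K.m.primeFactors) : (K.auxF c g p).deg ≤ K.m ^ 3 := by
  unfold auxF
  rw [AForm.deg_oneSub]
  have he : K.m.factorization p ≤ K.m := (Nat.factorization_lt p K.m_ne_zero).le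
  have hp1 : p - 1 ≤ K.m := (Nat.sub_le p 1).trans (Nat.le_of_mem_primeFactors hp)
  refine (AForm.deg_prodL_le (D := K.m * K.m) fun F hF => ?_).trans ?_
  · simp only [List.mem_map, List.mem_range] at hF
    obtain ⟨t, ht, rfl⟩ := hF
    rw [AForm.deg_oneSub, AForm.deg_pow]
    exact Nat.mul_le_mul hp1 ((deg_esymF_le K c g _).trans (K.pow_factorization_le hp ht.le))
  · rw [List.length_map, List.length_range]
    calc K.m.factorization p * (K.m * K.m) ≤ K.m * (K.m * K.m) := Nat.mul_le_mul_right _ he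
      _ = K.m ^ 3 := by ring

/-- `x^n + 1 ≤ (x+1)^n` for `n ≥ 1`. [folklore] -/
theorem pow_add_one_le {x n : ℕ} (hn : 1 ≤ n) : x ^ n + 1 ≤ (x + 1) ^ n := by
  obtain ⟨n, rfl⟩ : ∃ k, n = k + 1 := ⟨n - 1, by omega⟩
  have h1 : x ^ n ≤ (x + 1) ^ n := Nat.pow_le_pow_left (Nat.le_succ x) n
  calc x ^ (n + 1) + 1 = x ^ n * x + 1 := by rw [pow_succ]
    _ ≤ (x + 1) ^ n * x + (x + 1) ^ n := Nat.add_le_add (Nat.mul_le_mul_right _ h1) (Nat.one_le_pow _ _ (Nat.succ_pos x))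
    _ = (x + 1) ^ (n + 1) := by ring

/-- Weight of the AND polynomial: `≤ (3k+2)^{T₀}` for arity `k`. [cite: BeigelTarui1994, Lemma 2.5] -/
theorem wt_andF_le : (K.andF c j g).wt ≤ (3 * g.arity + 2) ^ K.T₀ := by
  unfold andF
  refine (AForm.wt_prodL_le (W := 3 * g.arity + 2) fun F hF => ?_).trans (by simp)
  simp only [List.mem_map, List.mem_range] at hF
  obtain ⟨t, -, rfl⟩ := hF
  rw [AForm.wt_oneSub]
  refine Nat.succ_le_succ ((AForm.wt_sumL_le (W := 3) fun G hG => ?_).trans ?_)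
  · simp only [List.mem_map, Finset.mem_toList] at hG
    obtain ⟨a, -, rfl⟩ := hG
    rw [AForm.wt_oneSub]
    exact Nat.succ_le_succ (wt_litF_le K c _)
  · rw [List.length_map, Finset.length_toList]
    have : #(K.sel c j g t) ≤ g.arity := (card_le_univ _).trans (by simp)
    nlinarith

/-- Weight of the OR polynomial: `≤ (3k+3)^{T₀}` for arity `k`. [cite: BeigelTarui1994, Lemma 2.5] -/
theorem wt_orF_le (hT : 1 ≤ K.T₀) : (K.orF c j g).wt ≤ (3 * g.arity + 3) ^ K.T₀ := by
  unfold orF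
  rw [AForm.wt_oneSub]
  refine le_trans (Nat.succ_le_succ ((AForm.wt_prodL_le (W := 3 * g.arity + 2) fun F hF => ?_).trans
    (le_of_eq (by simp)))) (pow_add_one_le hT)
  simp only [List.mem_map, List.mem_range] at hF
  obtain ⟨t, -, rfl⟩ := hF
  rw [AForm.wt_oneSub]
  refine Nat.succ_le_succ ((AForm.wt_sumL_le (W := 2) fun G hG => ?_).trans ?_)
  · simp only [List.mem_map, Finset.mem_toList] at hG
    obtain ⟨a, -, rfl⟩ := hG
    exact wt_litF_le K c _
  · rw [List.length_map, Finset.length_toList]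
    have : #(K.sel c j g t) ≤ g.arity := (card_le_univ _).trans (by simp)
    nlinarith

/-- Weight of the MOD polynomial: `≤ 3^{m+1}`. [cite: BeigelTarui1994, Lemma 2.5] -/
theorem wt_modF_le : (K.modF c j).wt ≤ 3 ^ (K.m + 1) := by
  unfold modF
  rw [AForm.wt_oneSub]
  have h1 : (AForm.prodL (K.m.primeFactors.toList.map fun p =>
      (AForm.var (Sum.inr (c, j, p)) : AForm (V n)).oneSub)).wt ≤ 2 ^ (K.m + 1) := by
    refine (AForm.wt_prodL_le (W := 2) fun F hF => ?_).trans ?_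
    · simp only [List.mem_map] at hF
      obtain ⟨p, -, rfl⟩ := hF
      rfl
    · rw [List.length_map]
      exact Nat.pow_le_pow_right (by norm_num) (length_primeFactors_toList_le K.m)
  exact (Nat.succ_le_succ h1).trans (pow_add_one_le (Nat.succ_pos _))

/-- Weight of `e_q`: `≤ k^q 2^q + 1` for arity `k`. [cite: BeigelTarui1994, Lemma 2.1] -/
theorem wt_esymF_le (q : ℕ) : (K.esymF c g q).wt ≤ g.arity ^ q * 2 ^ q + 1 := by
  unfold esymF
  refine (AForm.wt_sumL_le (W := 2 ^ q) fun F hF => ?_).trans ?_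
  · simp only [List.mem_map, Finset.mem_toList, mem_powersetCard] at hF
    obtain ⟨A, ⟨-, hA⟩, rfl⟩ := hF
    refine (AForm.wt_prodL_le (W := 2) fun G hG => ?_).trans (by rw [List.length_map, Finset.length_toList, hA])
    simp only [List.mem_map, Finset.mem_toList] at hG
    obtain ⟨a, -, rfl⟩ := hG
    exact wt_litF_le K c _
  · rw [List.length_map, Finset.length_toList, card_powersetCard, card_univ, Fintype.card_fin]
    exact Nat.succ_le_succ (Nat.mul_le_mul_right _ (Nat.choose_le_pow _ _))

/-- Weight of the auxiliary `MOD_{p^e}` polynomial: `≤ (2k+3)^{m³}` for arity `k`. [cite: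
BeigelTarui1994, Lemma 2.1] -/
theorem wt_auxF_le {p : ℕ} (hp : p ∈ K.m.primeFactors) :
    (K.auxF c g p).wt ≤ (2 * g.arity + 3) ^ K.m ^ 3 := by
  unfold auxF
  rw [AForm.wt_oneSub]
  have he : K.m.factorization p ≤ K.m := (Nat.factorization_lt p K.m_ne_zero).le
  have hp1 : p - 1 ≤ K.m := (Nat.sub_le p 1).trans (Nat.le_of_mem_primeFactors hp)
  have hm3 : 1 ≤ K.m ^ 3 := Nat.one_le_pow _ _ (Nat.pos_of_ne_zero K.m_ne_zero)
  set k := g.arity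
  -- each factor
  have hfac : ∀ t < K.m.factorization p,
      (((K.esymF c g (p ^ t)).pow (p - 1)).oneSub).wt ≤ (2 * k + 2) ^ (K.m * K.m) := by
    intro t ht
    have hq : p ^ t ≤ K.m := K.pow_factorization_le hp ht.le
    have hq1 : 1 ≤ p ^ t := Nat.one_le_pow _ _ (Nat.prime_of_mem_primeFactors hp).pos
    rw [AForm.wt_oneSub, AForm.wt_pow]
    have h1 : (K.esymF c g (p ^ t)).wt ≤ (2 * k + 1) ^ (p ^ t) := by
      refine (wt_esymF_le K c g _).trans ?_
      rw [← mul_pow]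
      refine (pow_add_one_le hq1).trans ?_
      exact Nat.pow_le_pow_left (by omega) _
    calc (K.esymF c g (p ^ t)).wt ^ (p - 1) + 1 ≤ ((2 * k + 1) ^ (p ^ t)) ^ (p - 1) + 1 :=
          Nat.succ_le_succ (Nat.pow_le_pow_left h1 _)
      _ = (2 * k + 1) ^ (p ^ t * (p - 1)) + 1 := by rw [pow_mul]
      _ ≤ (2 * k + 1) ^ (K.m * K.m) + 1 := by
          refine Nat.succ_le_succ (Nat.pow_le_pow_right (by omega) (Nat.mul_le_mul hq hp1))
      _ ≤ (2 * k + 2) ^ (K.m * K.m) := pow_add_one_le (Nat.one_le_iff_ne_zero.2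
          (Nat.mul_ne_zero K.m_ne_zero K.m_ne_zero))
  have hprod : (AForm.prodL ((List.range (K.m.factorization p)).map fun t =>
      ((K.esymF c g (p ^ t)).pow (p - 1)).oneSub)).wt ≤ (2 * k + 2) ^ K.m ^ 3 := by
    refine (AForm.wt_prodL_le (W := (2 * k + 2) ^ (K.m * K.m)) fun F hF => ?_).trans ?_
    · simp only [List.mem_map, List.mem_range] at hF
      obtain ⟨t, ht, rfl⟩ := hF
      exact hfac t ht
    · rw [List.length_map, List.length_range, ← pow_mul]
      refine Nat.pow_le_pow_right (by omega) ?_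
      rw [pow_succ, pow_two]
      exact Nat.mul_le_mul_left _ he
  exact (Nat.succ_le_succ hprod).trans (pow_add_one_le hm3)

/-- Variables of the AND/OR polynomials: literals of the arguments. [folklore] -/
theorem varsIn_andF_orF {P : V n → Prop} (hP : ∀ a, (K.litF c (g.args a)).VarsIn P) :
    (K.andF c j g).VarsIn P ∧ (K.orF c j g).VarsIn P := by
  have hfac : ∀ (F : AForm (V n)) (t : ℕ) (neg : Bool),
      F = (AForm.sumL ((K.sel c j g t).toList.map fun a =>
        if neg then (K.litF c (g.args a)).oneSub else K.litF c (g.args a))).oneSub → F.VarsIn P := by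
    rintro F t neg rfl
    refine (AForm.VarsIn_sumL fun G hG => ?_).oneSub
    simp only [List.mem_map, Finset.mem_toList] at hG
    obtain ⟨a, -, rfl⟩ := hG
    cases neg
    · exact hP a
    · exact (hP a).oneSub
  constructor
  · refine AForm.VarsIn_prodL fun F hF => ?_
    simp only [List.mem_map, List.mem_range] at hF
    obtain ⟨t, -, rfl⟩ := hF
    exact hfac _ t true rfl
  · refine (AForm.VarsIn_prodL fun F hF => ?_).oneSub
    simp only [List.mem_map, List.mem_range] at hF
    obtain ⟨t, -, rfl⟩ := hF
    exact hfac _ t false rfl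

/-- Variables of the MOD polynomial: the auxiliary variables of the gate. [folklore] -/
theorem varsIn_modF {P : V n → Prop} (hP : ∀ p ∈ K.m.primeFactors, P (.inr (c, j, p))) :
    (K.modF c j).VarsIn P := by
  refine (AForm.VarsIn_prodL fun F hF => ?_).oneSub
  simp only [List.mem_map, Finset.mem_toList] at hF
  obtain ⟨p, hp, rfl⟩ := hF
  exact (show (AForm.var (Sum.inr (c, j, p)) : AForm (V n)).VarsIn P from hP p hp).oneSub

/-- Variables of the auxiliary polynomial: those of the argument literals. [folklore] -/
theorem varsIn_auxF {P : V n → Prop} (hP : ∀ a, (K.litF c (g.args a)).VarsIn P) (p : ℕ) :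
    (K.auxF c g p).VarsIn P := by
  refine (AForm.VarsIn_prodL fun F hF => ?_).oneSub
  simp only [List.mem_map, List.mem_range] at hF
  obtain ⟨t, -, rfl⟩ := hF
  refine (AForm.VarsIn.pow ?_ _).oneSub
  refine AForm.VarsIn_sumL fun G hG => ?_
  simp only [List.mem_map, Finset.mem_toList] at hG
  obtain ⟨A, -, rfl⟩ := hG
  refine AForm.VarsIn_prodL fun H hH => ?_
  simp only [List.mem_map, Finset.mem_toList] at hH
  obtain ⟨a, -, rfl⟩ := hH
  exact hP a

end bounds

/-! ### Levels of the variables and the stage primes -/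

/-- Admissible variables: inputs, non-NOT gates of any copy, and the auxiliary `MOD_{p^e}`
variables of non-NOT gates for the primes `p ∣ m`. [folklore] -/
def Adm : V n → Prop
  | .inl _ => True
  | .inr (_, j, 0) => j < K.C.gates.length ∧ K.code j ≠ 0
  | .inr (_, j, q + 1) => j < K.C.gates.length ∧ K.code j ≠ 0 ∧ q + 1 ∈ K.m.primeFactors

/-- The level of a variable: a gate of depth `ℓ` sits at level `(m+1) ℓ`, its auxiliary variable
for the prime `p` at level `(m+1) ℓ - p`, the inputs at level `0`; every defining polynomial only
mentions variables of strictly smaller level, and all variables of one level share one prime.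
[cite: BeigelTarui1994, Lemma 2.8] -/
def level : V n → ℕ
  | .inl _ => 0
  | .inr (_, j, 0) => (K.m + 1) * wdepth K.C (.inr j)
  | .inr (_, j, q + 1) => (K.m + 1) * wdepth K.C (.inr j) - (q + 1)

/-- The prime modulo which a variable is defined by its polynomial (`2` for gates).
[cite: BeigelTarui1994, Lemma 2.8] -/
def primeOf : V n → ℕ
  | .inl _ => 2
  | .inr (_, _, 0) => 2
  | .inr (_, _, q + 1) => q + 1

/-- The prime of the variables of level `L`. [cite: BeigelTarui1994, Lemma 2.8] -/
def stagePrime (L : ℕ) : ℕ := if L % (K.m + 1) = 0 then 2 else K.m + 1 - L % (K.m + 1)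

/-- The defining polynomial of a variable. [cite: BeigelTarui1994, Lemma 2.5] -/
noncomputable def FF : V n → AForm (V n)
  | .inl _ => AForm.cst 0
  | .inr (c, j, 0) => K.gateF c j
  | .inr (c, j, q + 1) => K.auxFj c j (q + 1)

/-- A non-NOT gate has depth `≥ 1`. [folklore] -/
theorem one_le_wdepth {j : ℕ} (hj : j < K.C.gates.length) (hc : K.code j ≠ 0) :
    1 ≤ wdepth K.C (.inr j) := by
  rw [K.code_eq hj] at hc
  unfold wdepth
  rw [wireDepthOf_inr, getD_wdepths_eq acWeight K.C j hj, acWeight_eq_one_of_accCode_ne hc]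
  exact Nat.le_add_right 1 _

/-- The level of an auxiliary variable. [folklore] -/
theorem level_aux (c j : ℕ) {p : ℕ} (hp : 0 < p) :
    K.level (.inr (c, j, p)) = (K.m + 1) * wdepth K.C (.inr j) - p := by
  obtain ⟨q, rfl⟩ : ∃ q, p = q + 1 := ⟨p - 1, by omega⟩
  rfl

/-- Admissibility of an auxiliary variable. [folklore] -/
theorem adm_aux (c j : ℕ) {p : ℕ} (hp : 0 < p) :
    K.Adm (.inr (c, j, p)) ↔ j < K.C.gates.length ∧ K.code j ≠ 0 ∧ p ∈ K.m.primeFactors := by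
  obtain ⟨q, rfl⟩ : ∃ q, p = q + 1 := ⟨p - 1, by omega⟩
  rfl

/-- `primeOf` is a prime on admissible variables. [folklore] -/
theorem prime_primeOf {v : V n} (hv : K.Adm v) : (primeOf v).Prime := by
  rcases v with i | ⟨c, j, _ | q⟩
  · exact Nat.prime_two
  · exact Nat.prime_two
  · exact Nat.prime_of_mem_primeFactors hv.2.2

/-- `primeOf v - 1 ≤ m` on admissible variables. [folklore] -/
theorem primeOf_sub_one_le {v : V n} (hv : K.Adm v) : primeOf v - 1 ≤ K.m := by
  have hm := K.two_le_m
  rcases v with i | ⟨c, j, _ | q⟩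
  · show 2 - 1 ≤ K.m; omega
  · show 2 - 1 ≤ K.m; omega
  · have := Nat.le_of_mem_primeFactors hv.2.2
    show q + 1 - 1 ≤ K.m; omega

/-- All admissible variables of one nonzero level have the prime of that level. [folklore] -/
theorem stagePrime_level {v : V n} (hv : K.Adm v) (hl : K.level v ≠ 0) :
    K.stagePrime (K.level v) = primeOf v := by
  rcases v with i | ⟨c, j, _ | q⟩
  · exact absurd rfl hl
  · simp [stagePrime, level, primeOf, Nat.mul_mod_right]
  · obtain ⟨hj, hc, hp⟩ := hv
    have hw := K.one_le_wdepth hj hc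
    have hpm : q + 1 ≤ K.m := Nat.le_of_mem_primeFactors hp
    show (if ((K.m + 1) * wdepth K.C (.inr j) - (q + 1)) % (K.m + 1) = 0 then 2
      else K.m + 1 - ((K.m + 1) * wdepth K.C (.inr j) - (q + 1)) % (K.m + 1)) = q + 1
    have key : ((K.m + 1) * wdepth K.C (.inr j) - (q + 1)) % (K.m + 1) = K.m - q := by
      have h' : (K.m + 1) * wdepth K.C (.inr j) = (K.m + 1) * (wdepth K.C (.inr j) - 1) + (K.m + 1) := by
        rw [← Nat.mul_succ, Nat.succ_eq_add_one, Nat.sub_add_cancel hw]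
      have : (K.m + 1) * wdepth K.C (.inr j) - (q + 1) = (K.m - q) + (K.m + 1) * (wdepth K.C (.inr j) - 1) := by
        omega
      rw [this, Nat.add_mul_mod_self_left, Nat.mod_eq_of_lt (by omega)]
    rw [key, if_neg (by omega)]
    omega

/-- The defining equation of an admissible non-input variable: its value is the indicator
`[FF v ≢ 0 (mod primeOf v)]`. [cite: BeigelTarui1994, Lemma 2.1 and Lemma 2.5] -/
theorem val_eq_indNZ (x : Fin n → Bool) {v : V n} (hv : K.Adm v) (hl : K.level v ≠ 0) :
    K.val x v = AForm.indNZ (primeOf v) ((K.FF v).eval (K.val x)) := by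
  rcases v with i | ⟨c, j, _ | q⟩
  · exact absurd rfl hl
  · obtain ⟨hj, hc⟩ := hv
    exact K.val_gate_eq x c j hj (by rwa [← K.code_eq hj])
  · obtain ⟨hj, -, hp⟩ := hv
    exact K.val_aux_eq x c j hj hp

/-- Admissible variables of level `0` are inputs. [folklore] -/
theorem exists_inl_of_level {v : V n} (hv : K.Adm v) (hl : K.level v = 0) : ∃ i, v = .inl i := by
  rcases v with i | ⟨c, j, _ | q⟩
  · exact ⟨i, rfl⟩
  · exfalso
    obtain ⟨hj, hc⟩ := hv
    have hw := K.one_le_wdepth hj hc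
    have : (K.m + 1) * 1 ≤ (K.m + 1) * wdepth K.C (.inr j) := Nat.mul_le_mul_left _ hw
    change (K.m + 1) * wdepth K.C (.inr j) = 0 at hl
    omega
  · exfalso
    obtain ⟨hj, hc, hp⟩ := hv
    have hw := K.one_le_wdepth hj hc
    have hpm := Nat.le_of_mem_primeFactors hp
    have : (K.m + 1) * 1 ≤ (K.m + 1) * wdepth K.C (.inr j) := Nat.mul_le_mul_left _ hw
    change (K.m + 1) * wdepth K.C (.inr j) - (q + 1) = 0 at hl
    omega

/-- The exponent of a non-factor of `m` is `0`. [folklore] -/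
theorem factorization_eq_zero_of_not_mem {p : ℕ} (hp : p ∉ K.m.primeFactors) :
    K.m.factorization p = 0 :=
  Finsupp.notMem_support_iff.1 (by rwa [Nat.support_factorization])

/-- `m + 1 ≤ m³` (as `m ≥ 2`). [folklore] -/
theorem m_succ_le_cube : K.m + 1 ≤ K.m ^ 3 := by
  have := K.two_le_m
  calc K.m + 1 ≤ K.m * K.m := by nlinarith
    _ ≤ K.m * K.m * K.m := Nat.le_mul_of_pos_right _ (by omega)
    _ = K.m ^ 3 := by ring

/-- Degree of the defining polynomials. [cite: BeigelTarui1994, Lemma 2.1 and Lemma 2.5] -/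
theorem deg_FF_le (v : V n) : (K.FF v).deg ≤ K.T₀ + K.m ^ 3 := by
  have hm3 := K.m_succ_le_cube
  rcases v with i | ⟨c, j, _ | q⟩
  · exact Nat.zero_le _
  · show (K.gateF c j).deg ≤ _
    unfold gateF
    split_ifs with hj h1 h2
    · exact (K.deg_andF_le c j _).trans (Nat.le_add_right _ _)
    · exact (K.deg_orF_le c j _).trans (Nat.le_add_right _ _)
    · exact (K.deg_modF_le c j).trans (hm3.trans (Nat.le_add_left _ _))
    · exact Nat.zero_le _
  · show (K.auxFj c j (q + 1)).deg ≤ _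
    unfold auxFj
    split_ifs with hj
    · by_cases hp : q + 1 ∈ K.m.primeFactors
      · exact (K.deg_auxF_le c _ hp).trans (Nat.le_add_left _ _)
      · simp [auxF, K.factorization_eq_zero_of_not_mem hp, AForm.prodL, AForm.deg]
    · exact Nat.zero_le _

/-- Weight of the defining polynomials. [cite: BeigelTarui1994, §2.4] -/
theorem wt_FF_le {s : ℕ} (hfan : K.C.maxFanIn ≤ s) (hT : 1 ≤ K.T₀) (v : V n) :
    (K.FF v).wt ≤ (3 * s + 3) ^ (K.T₀ + K.m ^ 3) := by
  have hm3 := K.m_succ_le_cube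
  have hX : 1 ≤ 3 * s + 3 := by omega
  have hN : ∀ {y k : ℕ}, y ≤ 3 * s + 3 → k ≤ K.T₀ + K.m ^ 3 → y ^ k ≤ (3 * s + 3) ^ (K.T₀ + K.m ^ 3) :=
    fun hy hk => (Nat.pow_le_pow_left hy _).trans (Nat.pow_le_pow_right hX hk)
  have h1 : 1 ≤ (3 * s + 3) ^ (K.T₀ + K.m ^ 3) := Nat.one_le_pow _ _ hX
  have harity : ∀ {j : ℕ} (hj : j < K.C.gates.length), (K.C.gates[j]).arity ≤ s := fun hj =>
    (arity_le_maxFanIn K.C (List.getElem_mem hj)).trans hfan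
  rcases v with i | ⟨c, j, _ | q⟩
  · simpa [FF, AForm.wt] using h1
  · show (K.gateF c j).wt ≤ _
    unfold gateF
    split_ifs with hj h1' h2'
    · refine (K.wt_andF_le c j _).trans (hN ?_ (Nat.le_add_right _ _))
      have := harity hj; omega
    · refine (K.wt_orF_le c j _ hT).trans (hN ?_ (Nat.le_add_right _ _))
      have := harity hj; omega
    · exact (K.wt_modF_le c j).trans (hN (by omega) (hm3.trans (Nat.le_add_left _ _)))
    · simpa [AForm.wt] using h1
  · show (K.auxFj c j (q + 1)).wt ≤ _
    unfold auxFj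
    split_ifs with hj
    · by_cases hp : q + 1 ∈ K.m.primeFactors
      · refine (K.wt_auxF_le c _ hp).trans (hN ?_ (Nat.le_add_left _ _))
        have := harity hj; omega
      · have : (K.auxF c (K.C.gates[j]) (q + 1)).wt = 2 := by
          simp [auxF, K.factorization_eq_zero_of_not_mem hp, AForm.prodL, AForm.wt]
        rw [this]
        calc 2 ≤ (3 * s + 3) ^ 1 := by rw [pow_one]; omega
          _ ≤ _ := Nat.pow_le_pow_right hX (le_add_right hT)
    · simpa [AForm.wt] using h1

/-- From a depth inequality between wires to a level inequality. [folklore] -/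
theorem level_step {w : Fin n ⊕ ℕ} {j : ℕ} (hlt : wdepth K.C w < wdepth K.C (.inr j)) :
    (K.m + 1) * wdepth K.C w + (K.m + 1) ≤ (K.m + 1) * wdepth K.C (.inr j) := by
  have := Nat.mul_le_mul_left (K.m + 1) (Nat.succ_le_of_lt hlt)
  rwa [Nat.mul_succ] at this

/-- The defining polynomial of a variable mentions only admissible variables of smaller
level. [cite: BeigelTarui1994, Lemma 2.8] -/
theorem varsIn_FF {v : V n} (hv : K.Adm v) (hl : K.level v ≠ 0) :
    (K.FF v).VarsIn fun w => K.Adm w ∧ K.level w + 1 ≤ K.level v := by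
  rcases v with i | ⟨c, j, _ | q⟩
  · exact absurd rfl hl
  · obtain ⟨hj, hc⟩ := hv
    have hc' : accCode K.m (K.C.gates[j]).fn ≠ 0 := by rwa [← K.code_eq hj]
    have hw := K.one_le_wdepth hj hc
    have hlit : ∀ a : Fin (K.C.gates[j]).arity, (K.litF c ((K.C.gates[j]).args a)).VarsIn
        fun w => K.Adm w ∧ K.level w + 1 ≤ K.level (.inr (c, j, 0)) := by
      intro a
      refine (K.varsIn_litF c _ (fun m' hm' => (K.C.wf j hj a m' hm').trans hj)).mono fun w hw' => ?_
      rcases hw' with ⟨i, rfl⟩ | ⟨j', rfl, hj', hc'', hd⟩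
      · refine ⟨trivial, ?_⟩
        show 0 + 1 ≤ (K.m + 1) * wdepth K.C (.inr j)
        nlinarith
      · refine ⟨⟨hj', hc''⟩, ?_⟩
        show (K.m + 1) * wdepth K.C (.inr j') + 1 ≤ (K.m + 1) * wdepth K.C (.inr j)
        have hlt := wdepth_args_lt K.C hj hc' a
        rw [← hd] at hlt
        have := K.level_step hlt
        omega
    show (K.gateF c j).VarsIn _
    unfold gateF
    rw [dif_pos hj]
    split_ifs with h1 h2
    · exact (K.varsIn_andF_orF c j _ hlit).1
    · exact (K.varsIn_andF_orF c j _ hlit).2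
    · refine K.varsIn_modF c j fun p hp => ?_
      have hp0 : 0 < p := (Nat.prime_of_mem_primeFactors hp).pos
      have hpm : p ≤ K.m := Nat.le_of_mem_primeFactors hp
      refine ⟨(K.adm_aux c j hp0).2 ⟨hj, hc, hp⟩, ?_⟩
      rw [K.level_aux c j hp0]
      show (K.m + 1) * wdepth K.C (.inr j) - p + 1 ≤ (K.m + 1) * wdepth K.C (.inr j)
      have : (K.m + 1) * 1 ≤ (K.m + 1) * wdepth K.C (.inr j) := Nat.mul_le_mul_left _ hw
      omega
  · obtain ⟨hj, hc, hp⟩ := hv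
    have hc' : accCode K.m (K.C.gates[j]).fn ≠ 0 := by rwa [← K.code_eq hj]
    have hw := K.one_le_wdepth hj hc
    have hpm : q + 1 ≤ K.m := Nat.le_of_mem_primeFactors hp
    have hbase : (K.m + 1) * 1 ≤ (K.m + 1) * wdepth K.C (.inr j) := Nat.mul_le_mul_left _ hw
    show (K.auxFj c j (q + 1)).VarsIn _
    unfold auxFj
    rw [dif_pos hj]
    refine K.varsIn_auxF c _ (fun a => ?_) (q + 1)
    refine (K.varsIn_litF c _ (fun m' hm' => (K.C.wf j hj a m' hm').trans hj)).mono fun w hw' => ?_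
    rcases hw' with ⟨i, rfl⟩ | ⟨j', rfl, hj', hc'', hd⟩
    · refine ⟨trivial, ?_⟩
      show 0 + 1 ≤ (K.m + 1) * wdepth K.C (.inr j) - (q + 1)
      omega
    · refine ⟨⟨hj', hc''⟩, ?_⟩
      show (K.m + 1) * wdepth K.C (.inr j') + 1 ≤ (K.m + 1) * wdepth K.C (.inr j) - (q + 1)
      have hlt := wdepth_args_lt K.C hj hc' a
      rw [← hd] at hlt
      have := K.level_step hlt
      omega

/-! ### The collapse, level by level (Beigel–Tarui 1994, §2.3) -/

/-- The invariant of the collapse once all levels `> L` are eliminated: the circuit value is a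
function `h` of the value of an integer formula `R` in the admissible variables of level `≤ L`,
of degree `≤ λ^E` and weight `≤ 2^(λ^E)`. [cite: BeigelTarui1994, Lemma 2.8] -/
def Inv (lam L E : ℕ) : Prop :=
  ∃ (R : AForm (V n)) (h : ℤ → Bool), (∀ x, K.C.eval x = h (R.eval (K.val x))) ∧
    R.VarsIn (fun v => K.Adm v ∧ K.level v ≤ L) ∧ R.deg ≤ lam ^ E ∧ R.wt ≤ 2 ^ lam ^ E

/-- **One collapse stage** (Beigel–Tarui 1994, Lemma 2.8 / §2.3): the variables of level `L+1`
(all defined modulo the same prime `p`) are replaced by the modulus-amplified Fermat powers of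
their defining polynomials; the old value is decoded from the new one modulo `p^(2^κ) > 2·wt`,
and degree and weight stay quasi-polynomially bounded. [cite: BeigelTarui1994, Lemma 2.8] -/
theorem inv_step {lam a DF WF L E : ℕ} (h2 : 2 ≤ lam) (hE : 1 ≤ E)
    (hD : ∀ v, (K.FF v).deg ≤ DF) (hW : ∀ v, (K.FF v).wt ≤ WF) (hW1 : 1 ≤ WF)
    (hDF : K.m * DF ≤ lam ^ a) (hWF : 5 * WF ^ K.m ≤ 2 ^ lam ^ a)
    (hI : K.Inv lam (L + 1) E) : K.Inv lam L (3 * E + a + 5) := by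
  classical
  obtain ⟨R, h, hev, hvars, hdeg, hwt⟩ := hI
  have h1 : 1 ≤ lam := le_trans one_le_two h2
  have hdeg' : R.deg ≤ lam ^ (3 * E + a + 5) := hdeg.trans (Nat.pow_le_pow_right h1 (by omega))
  have hwt' : R.wt ≤ 2 ^ lam ^ (3 * E + a + 5) :=
    hwt.trans (Nat.pow_le_pow_right two_pos (Nat.pow_le_pow_right h1 (by omega)))
  by_cases hex : ∃ v, K.Adm v ∧ K.level v = L + 1
  swap
  · refine ⟨R, h, hev, hvars.mono fun v hv => ⟨hv.1, ?_⟩, hdeg', hwt'⟩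
    by_contra hc
    exact hex ⟨v, hv.1, by have := hv.2; omega⟩
  obtain ⟨v₀, hv₀, hl₀⟩ := hex
  have hpB : ∀ v, K.Adm v → K.level v = L + 1 → primeOf v = primeOf v₀ := fun v hv hl => by
    rw [← K.stagePrime_level hv (by omega), ← K.stagePrime_level hv₀ (by omega), hl, hl₀]
  set p := primeOf v₀ with hp_def
  have hp : p.Prime := K.prime_primeOf hv₀
  have hp2 : 2 ≤ p := hp.two_le
  have hpm : p - 1 ≤ K.m := K.primeOf_sub_one_le hv₀
  -- the batch and the amplification depth
  let B : V n → Prop := fun v => K.Adm v ∧ K.level v = L + 1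
  set W := R.wt with hW_def
  set κ : ℕ := Nat.log 2 (Nat.log 2 W + 2) + 1 with hκ_def
  have hκ1 : Nat.log 2 W + 2 < 2 ^ κ := Nat.lt_pow_succ_log_self one_lt_two _
  have h2E : 2 ≤ lam ^ E := le_trans h2 (by simpa using Nat.pow_le_pow_right h1 hE)
  have hκ2 : 2 ^ κ ≤ 4 * lam ^ E := by
    have hlogW : Nat.log 2 W ≤ lam ^ E :=
      calc Nat.log 2 W ≤ Nat.log 2 (2 ^ lam ^ E) := Nat.log_mono_right hwt
        _ = lam ^ E := Nat.log_pow one_lt_two _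
    calc 2 ^ κ = 2 ^ Nat.log 2 (Nat.log 2 W + 2) * 2 := pow_succ _ _
      _ ≤ (Nat.log 2 W + 2) * 2 := Nat.mul_le_mul_right _ (Nat.pow_log_le_self 2 (by omega))
      _ ≤ (lam ^ E + lam ^ E) * 2 := Nat.mul_le_mul_right _ (add_le_add hlogW h2E)
      _ = 4 * lam ^ E := by ring
  have h3κ : 3 ^ κ ≤ lam ^ (2 * E + 4) := by
    have h16 : 16 ≤ lam ^ 4 := by
      calc 16 = 2 ^ 4 := rfl
        _ ≤ lam ^ 4 := Nat.pow_le_pow_left h2 4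
    calc 3 ^ κ ≤ 4 ^ κ := Nat.pow_le_pow_left (by norm_num) _
      _ = (2 ^ κ) ^ 2 := by rw [sq, ← mul_pow]; norm_num
      _ ≤ (4 * lam ^ E) ^ 2 := Nat.pow_le_pow_left hκ2 2
      _ = 16 * lam ^ (2 * E) := by ring
      _ ≤ lam ^ 4 * lam ^ (2 * E) := Nat.mul_le_mul_right _ h16
      _ = lam ^ (2 * E + 4) := by rw [← pow_add, add_comm]
  -- the modulus exceeds twice the weight
  have hKW : 2 * (W : ℤ) < (p : ℤ) ^ 2 ^ κ := by
    have hWlt : W < 2 ^ (Nat.log 2 W + 1) := Nat.lt_pow_succ_log_self one_lt_two W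
    have hnat : 2 * W < p ^ 2 ^ κ :=
      calc 2 * W < 2 * 2 ^ (Nat.log 2 W + 1) := by omega
        _ = 2 ^ (Nat.log 2 W + 2) := by ring
        _ ≤ 2 ^ 2 ^ κ := Nat.pow_le_pow_right two_pos hκ1.le
        _ ≤ p ^ 2 ^ κ := Nat.pow_le_pow_left hp2 _
    exact_mod_cast hnat
  -- the new formula and the new decoding
  let τ : V n → AForm (V n) := AForm.collapseSubst B K.FF p κ
  refine ⟨R.subst τ, fun z => h ((z + W) % ((p : ℤ) ^ 2 ^ κ) - W), fun x => ?_, ?_, ?_, ?_⟩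
  · have hB : ∀ v, B v → K.val x v = AForm.indNZ p ((K.FF v).eval (K.val x)) := fun v hv => by
      rw [← hpB v hv.1 hv.2]
      exact K.val_eq_indNZ x hv.1 (by simp only [hv.2]; omega)
    have hmod := AForm.eval_modEq_eval_collapse (B := B) (F := K.FF) hp κ hB R
    have habs : |R.eval (K.val x)| ≤ (W : ℤ) := AForm.abs_eval_le_wt (K.abs_val_le x) R
    show K.C.eval x = h (((R.subst τ).eval (K.val x) + W) % ((p : ℤ) ^ 2 ^ κ) - W)
    rw [hev x, AForm.decode_eq hKW habs hmod.symm]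
  · refine AForm.VarsIn_subst (fun v hv => AForm.VarsIn_collapseSubst
      (Q := fun w => K.Adm w ∧ K.level w ≤ L) (fun w hw => ?_) (fun w hw hnb => ?_) v hv) hvars
    · exact (K.varsIn_FF hw.1 (by simp only [hw.2]; omega)).mono fun u hu =>
        ⟨hu.1, by have := hu.2; have := hw.2; omega⟩
    · refine ⟨hw.1, ?_⟩
      by_contra hc
      exact hnb ⟨hw.1, by have := hw.2; omega⟩
  · -- degree
    have hτ : ∀ v, (τ v).deg ≤ max 1 (3 ^ κ * ((p - 1) * DF)) := fun v =>
      AForm.deg_collapseSubst_le (fun v _ => hD v) v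
    refine (AForm.deg_subst_le hτ R).trans ?_
    have hX : 3 ^ κ * ((p - 1) * DF) ≤ lam ^ (2 * E + 4) * lam ^ a :=
      Nat.mul_le_mul h3κ ((Nat.mul_le_mul_right _ hpm).trans hDF)
    have hmax : max 1 (3 ^ κ * ((p - 1) * DF)) ≤ lam ^ (2 * E + 4) * lam ^ a :=
      max_le (Nat.succ_le_of_lt (Nat.mul_pos (Nat.pow_pos (by omega)) (Nat.pow_pos (by omega)))) hX
    calc R.deg * max 1 (3 ^ κ * ((p - 1) * DF)) ≤ lam ^ E * (lam ^ (2 * E + 4) * lam ^ a) :=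
          Nat.mul_le_mul hdeg hmax
      _ = lam ^ (3 * E + a + 4) := by rw [← pow_add, ← pow_add]; congr 1; ring
      _ ≤ lam ^ (3 * E + a + 5) := Nat.pow_le_pow_right h1 (by omega)
  · -- weight
    set Bw := (5 * WF ^ (p - 1)) ^ 3 ^ κ with hBw
    have hτ : ∀ v, (τ v).wt ≤ Bw := fun v => AForm.wt_collapseSubst_le hW1 (fun v _ => hW v) v
    have hBw1 : 1 ≤ Bw := Nat.one_le_pow _ _ (Nat.mul_pos (by norm_num) (Nat.pow_pos hW1))
    refine (AForm.wt_subst_le hBw1 hτ R).trans ?_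
    have hBw2 : Bw ≤ 2 ^ (lam ^ a * 3 ^ κ) := by
      rw [pow_mul]
      refine Nat.pow_le_pow_left ?_ _
      calc 5 * WF ^ (p - 1) ≤ 5 * WF ^ K.m := Nat.mul_le_mul_left _ (Nat.pow_le_pow_right hW1 hpm)
        _ ≤ 2 ^ lam ^ a := hWF
    have h3 : lam ^ a * 3 ^ κ * lam ^ E ≤ lam ^ (3 * E + a + 4) :=
      calc lam ^ a * 3 ^ κ * lam ^ E ≤ lam ^ a * lam ^ (2 * E + 4) * lam ^ E :=
            Nat.mul_le_mul_right _ (Nat.mul_le_mul_left _ h3κ)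
        _ = lam ^ (3 * E + a + 4) := by rw [← pow_add, ← pow_add]; congr 1; ring
    have h4 : lam ^ E ≤ lam ^ (3 * E + a + 4) := Nat.pow_le_pow_right h1 (by omega)
    have hexp : lam ^ E + lam ^ a * 3 ^ κ * lam ^ E ≤ lam ^ (3 * E + a + 5) :=
      calc lam ^ E + lam ^ a * 3 ^ κ * lam ^ E ≤ lam ^ (3 * E + a + 4) + lam ^ (3 * E + a + 4) :=
            add_le_add h4 h3
        _ = 2 * lam ^ (3 * E + a + 4) := by ring
        _ ≤ lam * lam ^ (3 * E + a + 4) := Nat.mul_le_mul_right _ h2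
        _ = lam ^ (3 * E + a + 4 + 1) := by rw [← pow_succ']
    calc R.wt * Bw ^ R.deg ≤ 2 ^ lam ^ E * (2 ^ (lam ^ a * 3 ^ κ)) ^ lam ^ E :=
          Nat.mul_le_mul hwt ((Nat.pow_le_pow_left hBw2 _).trans (Nat.pow_le_pow_right (by positivity) hdeg))
      _ = 2 ^ (lam ^ E + lam ^ a * 3 ^ κ * lam ^ E) := by rw [← pow_mul, ← pow_add]
      _ ≤ 2 ^ lam ^ (3 * E + a + 5) := Nat.pow_le_pow_right two_pos hexp

/-! ### The last stage: expansion into a `SYM⁺` circuit -/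

/-- Sums of termwise congruent lists are congruent. [folklore] -/
theorem list_sum_modEq {α : Type*} {M : ℤ} (l : List α) {f g : α → ℤ} (h : ∀ a ∈ l, f a ≡ g a [ZMOD M]) :
    (l.map f).sum ≡ (l.map g).sum [ZMOD M] := by
  induction l with
  | nil => simp
  | cons a l ih =>
    simp only [List.map_cons, List.sum_cons]
    exact (h a (by simp)).add (ih fun b hb => h b (by simp [hb]))

/-- Counting in a concatenation of replicated blocks. [folklore] -/
theorem countP_flatMap_replicate {α β : Type*} (l : List α) (k : α → ℕ) (t : α → β) (P : β → Bool) :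
    (l.flatMap fun a => List.replicate (k a) (t a)).countP P =
      (l.map fun a => if P (t a) = true then k a else 0).sum := by
  induction l with
  | nil => simp
  | cons a l ih => simp [List.flatMap_cons, List.countP_append, ih, List.countP_replicate]

/-- Length of a concatenation of replicated blocks. [folklore] -/
theorem length_flatMap_replicate {α β : Type*} (l : List α) (k : α → ℕ) (t : α → β) :
    (l.flatMap fun a => List.replicate (k a) (t a)).length = (l.map k).sum := by
  induction l with
  | nil => simp
  | cons a l ih => simp [List.flatMap_cons, ih]

/-- **From the collapsed polynomial to a `SYM⁺` circuit** (Beigel–Tarui 1994, end of §2.3 and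
proof of Thm. 1.1; Williams 2014, App. A, Transformation 4): expand the integer polynomial in
the inputs into multilinear monomials, realize a coefficient `a` as `a mod K` copies of the
AND-term (`K = 2·norm + 1`), and let the symmetric gate decode the count modulo `K`. [cite: BeigelTarui1994, Thm. 1.1] -/
theorem symPlus_of_inv {lam E : ℕ} (h2 : 2 ≤ lam) (hI : K.Inv lam 0 E) :
    ∃ S : SymPlus n, S.size ≤ 2 ^ lam ^ (E + 2) ∧ S.maxFanIn ≤ lam ^ (E + 2) ∧
      ∀ x, S.eval x = K.C.eval x := by
  classical
  obtain ⟨R, h, hev, hvars, hdeg, hwt⟩ := hI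
  have h1 : 1 ≤ lam := le_trans one_le_two h2
  have hinp : R.VarsIn fun v => ∃ i, v = Sum.inl i :=
    hvars.mono fun v hv => K.exists_inl_of_level hv.1 (Nat.le_zero.1 hv.2)
  -- the `{0,1}`-point of an input (auxiliary coordinates set to `0`)
  let ν : (Fin n → Bool) → V n → ℤ := fun x v => Sum.elim (fun i => b2i (x i)) (fun _ => 0) v
  have hν01 : ∀ x v, ν x v = 0 ∨ ν x v = 1 := fun x v => by
    rcases v with i | t
    · exact b2i_zero_or_one (x i)
    · exact Or.inl rfl
  have hνabs : ∀ x v, |ν x v| ≤ 1 := fun x v => by rcases hν01 x v with h | h <;> simp [h]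
  have hevν : ∀ x, R.eval (K.val x) = R.eval (ν x) := fun x =>
    AForm.eval_congr_of_varsIn (fun v ⟨i, hi⟩ => by subst hi; rfl) hinp
  -- the terms
  let toIn : Finset (V n) → Finset (Fin n) := fun A => univ.filter fun i => Sum.inl i ∈ A
  let Kf : ℕ := 2 * R.wt + 1
  let terms : List (Finset (Fin n)) :=
    R.expand.flatMap fun q => List.replicate (q.1 % (Kf : ℤ)).toNat (toIn q.2)
  have hKf0 : (0 : ℤ) < Kf := by positivity
  have hKW : 2 * (R.wt : ℤ) < Kf := by push_cast [Kf]; linarith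
  have hmono : ∀ x, ∀ q ∈ R.expand, AForm.mono (ν x) q.2 = b2i (decide (∀ i ∈ toIn q.2, x i = true)) := by
    intro x q hq
    have hq' := AForm.forall_mem_expand_of_varsIn hinp q hq
    have key : (∀ v ∈ q.2, ν x v = 1) ↔ ∀ i ∈ toIn q.2, x i = true := by
      constructor
      · intro hall i hi
        have hi' : Sum.inl i ∈ q.2 := (mem_filter.1 hi).2
        have h1' := hall _ hi'
        cases hx : x i
        · simp [ν, hx] at h1'
        · rfl
      · intro hall v hv
        obtain ⟨i, rfl⟩ := hq' v hv
        have := hall i (mem_filter.2 ⟨mem_univ _, hv⟩)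
        simp [ν, this]
    unfold AForm.mono
    by_cases hc : ∀ v ∈ q.2, ν x v = 1
    · rw [if_pos hc, decide_eq_true (key.1 hc)]; rfl
    · rw [if_neg hc, decide_eq_false (fun h' => hc (key.2 h'))]; rfl
  let S : SymPlus n := ⟨terms, fun N => h ((((N : ℕ) : ℤ) + R.wt) % (Kf : ℤ) - R.wt)⟩
  refine ⟨S, ?_, ?_, fun x => ?_⟩
  · -- size
    show terms.length ≤ _
    rw [length_flatMap_replicate]
    have hsum : (R.expand.map fun q => (q.1 % (Kf : ℤ)).toNat).sum ≤ R.expand.length * Kf := by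
      have := List.sum_le_card_nsmul (R.expand.map fun q => (q.1 % (Kf : ℤ)).toNat) Kf (by
        intro y hy
        simp only [List.mem_map] at hy
        obtain ⟨q, -, rfl⟩ := hy
        exact Int.toNat_le.2 (Int.emod_lt_of_pos _ hKf0).le)
      simpa [List.length_map, smul_eq_mul] using this
    refine hsum.trans ?_
    have hlen := AForm.length_expand_le_wt R
    have h22 : 2 * lam ^ E + 2 ≤ lam ^ (E + 2) := by
      have : 4 * lam ^ E ≤ lam ^ (E + 2) := by
        rw [pow_add]
        calc 4 * lam ^ E = lam ^ E * 2 ^ 2 := by ring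
          _ ≤ lam ^ E * lam ^ 2 := Nat.mul_le_mul_left _ (Nat.pow_le_pow_left h2 2)
      have h1E : 1 ≤ lam ^ E := Nat.one_le_pow _ _ (by omega)
      omega
    calc R.expand.length * Kf ≤ R.wt * Kf := Nat.mul_le_mul_right _ hlen
      _ ≤ 2 ^ lam ^ E * 2 ^ (lam ^ E + 2) := by
          refine Nat.mul_le_mul hwt ?_
          show 2 * R.wt + 1 ≤ 2 ^ (lam ^ E + 2)
          calc 2 * R.wt + 1 ≤ 2 * 2 ^ lam ^ E + 2 ^ lam ^ E := by
                have := Nat.one_le_two_pow (n := lam ^ E); omega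
            _ ≤ 4 * 2 ^ lam ^ E := by omega
            _ = 2 ^ (lam ^ E + 2) := by rw [pow_add]; ring
      _ = 2 ^ (2 * lam ^ E + 2) := by rw [← pow_add]; congr 1; ring
      _ ≤ 2 ^ lam ^ (E + 2) := Nat.pow_le_pow_right two_pos h22
  · -- fan-in
    refine SymPlus.maxFanIn_le fun t ht => ?_
    simp only [S, terms, List.mem_flatMap, List.mem_replicate] at ht
    obtain ⟨q, hq, -, rfl⟩ := ht
    calc (toIn q.2).card ≤ q.2.card := Finset.card_le_card_of_injOn Sum.inl
          (fun i hi => (mem_filter.1 hi).2) (fun a _ b _ hab => Sum.inl_injective hab)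
      _ ≤ R.deg := AForm.card_le_deg_of_mem_expand R hq
      _ ≤ lam ^ E := hdeg
      _ ≤ lam ^ (E + 2) := Nat.pow_le_pow_right h1 (by omega)
  · -- value
    have hcount : ((S.count x : ℕ) : ℤ) ≡ R.eval (ν x) [ZMOD Kf] := by
      rw [show S.count x = _ from countP_flatMap_replicate R.expand (fun q => (q.1 % (Kf : ℤ)).toNat)
        (fun q => toIn q.2) (fun t => decide (∀ i ∈ t, x i = true)), Nat.cast_list_sum, List.map_map,
        AForm.eval_eq_expand (hν01 x) R]
      refine list_sum_modEq _ fun q hq => ?_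
      simp only [Function.comp_apply]
      rw [hmono x q hq]
      split_ifs with hs
      · have hs' : ∀ i ∈ toIn q.2, x i = true := of_decide_eq_true hs
        rw [decide_eq_true hs', b2i_true, mul_one, Int.toNat_of_nonneg (Int.emod_nonneg _ hKf0.ne')]
        exact Int.mod_modEq _ _
      · have hs' : ¬ ∀ i ∈ toIn q.2, x i = true := fun h' => hs (decide_eq_true h')
        rw [decide_eq_false hs', b2i_false, mul_zero, Nat.cast_zero]
    show h ((((S.count x : ℕ) : ℤ) + R.wt) % (Kf : ℤ) - R.wt) = K.C.eval x
    rw [AForm.decode_eq hKW (AForm.abs_eval_le_wt (hνabs x) R) hcount, ← hevν x, ← hev x]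

/-- **The first stage** (Beigel–Tarui 1994, Lemma 2.5: majority of the derandomized copies):
the circuit value is `[T < 2 · Σ_c (output literal of copy c)]`, a degree-`1` formula in the
gate variables of level `≤ (m+1)·depth`. [cite: BeigelTarui1994, Lemma 2.5] -/
theorem inv_init {lam d T : ℕ} (h2 : 2 ≤ lam) (hT : T + 1 ≤ 2 ^ lam) (hdepth : K.C.acDepth ≤ d)
    (hmaj : ∀ x, K.C.eval x = decide (T < 2 * #(univ.filter fun c : Fin T =>
      (rand K.m K.T₀ (K.βs c) K.C).eval x = true))) :
    K.Inv lam ((K.m + 1) * d) 2 := by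
  have h1 : 1 ≤ lam := le_trans one_le_two h2
  refine ⟨AForm.sumL ((List.finRange T).map fun c : Fin T => K.litF c.val K.C.output),
    fun z => decide ((T : ℤ) < 2 * z), fun x => ?_, ?_, ?_, ?_⟩
  · rw [hmaj x, AForm.eval_sumL, List.map_map]
    have hsum : ((List.finRange T).map (AForm.eval (K.val x) ∘ fun c : Fin T => K.litF c.val K.C.output)).sum =
        (#(univ.filter fun c : Fin T => (rand K.m K.T₀ (K.βs c) K.C).eval x = true) : ℤ) := by
      rw [← Fin.sum_univ_def, ← sum_b2i_eq_card]
      refine Finset.sum_congr rfl fun c _ => ?_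
      simp only [Function.comp_apply, eval_litF]
      rw [show K.rv c x K.C.output = (rand K.m K.T₀ (K.βs c) K.C).eval x from
        (eval_eq_tval (rand K.m K.T₀ (K.βs c) K.C) x).symm]
      cases (rand K.m K.T₀ (K.βs c) K.C).eval x <;> rfl
    rw [hsum]
    exact decide_eq_decide.2 ⟨fun h => by exact_mod_cast h, fun h => by exact_mod_cast h⟩
  · refine AForm.VarsIn_sumL fun F hF => ?_
    simp only [List.mem_map] at hF
    obtain ⟨c, -, rfl⟩ := hF
    refine (K.varsIn_litF c K.C.output K.C.wf_output).mono fun w hw => ?_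
    rcases hw with ⟨i, rfl⟩ | ⟨j', rfl, hj', hc', hd⟩
    · exact ⟨trivial, Nat.zero_le _⟩
    · refine ⟨⟨hj', hc'⟩, ?_⟩
      show (K.m + 1) * wdepth K.C (.inr j') ≤ (K.m + 1) * d
      rw [hd, ← acDepth_eq_wdepth]
      exact Nat.mul_le_mul_left _ hdepth
  · refine (AForm.deg_sumL_le (D := 1) fun F hF => ?_).trans (Nat.one_le_pow _ _ (by omega))
    simp only [List.mem_map] at hF
    obtain ⟨c, -, rfl⟩ := hF
    exact (K.deg_litF c _).le
  · refine (AForm.wt_sumL_le (W := 2) fun F hF => ?_).trans ?_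
    · simp only [List.mem_map] at hF
      obtain ⟨c, -, rfl⟩ := hF
      exact K.wt_litF_le c _
    · rw [List.length_map, List.length_finRange]
      calc T * 2 + 1 ≤ 2 * 2 ^ lam := by omega
        _ = 2 ^ (lam + 1) := by rw [← pow_succ']
        _ ≤ 2 ^ lam ^ 2 := Nat.pow_le_pow_right two_pos (by nlinarith)

end Setup

/-- The exponent after `L` further collapse stages, starting from exponent `E`
(`E ↦ 3E + a + 5` per stage). [folklore] -/
def iterE (a : ℕ) : ℕ → ℕ → ℕ
  | 0, E => E
  | L + 1, E => iterE a L (3 * E + a + 5)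

namespace Setup

variable {n : ℕ} (K : Setup n)

/-- Running all the stages. [cite: BeigelTarui1994, §2.3] -/
theorem inv_zero_of_inv {lam a DF WF : ℕ} (h2 : 2 ≤ lam)
    (hD : ∀ v, (K.FF v).deg ≤ DF) (hW : ∀ v, (K.FF v).wt ≤ WF) (hW1 : 1 ≤ WF)
    (hDF : K.m * DF ≤ lam ^ a) (hWF : 5 * WF ^ K.m ≤ 2 ^ lam ^ a) :
    ∀ (L : ℕ) {E : ℕ}, 1 ≤ E → K.Inv lam L E → K.Inv lam 0 (iterE a L E)
  | 0, _, _, hI => hI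
  | L + 1, _, hE, hI =>
    inv_zero_of_inv h2 hD hW hW1 hDF hWF L (by omega) (K.inv_step h2 hE hD hW hW1 hDF hWF hI)

end Setup

/-! ### Polylogarithmic bookkeeping -/

/-- `λ + c ≤ λ^(c+1)` for `λ ≥ 2`. [folklore] -/
theorem self_add_le_pow {lam : ℕ} (h2 : 2 ≤ lam) : ∀ c : ℕ, lam + c ≤ lam ^ (c + 1)
  | 0 => by simp
  | c + 1 => by
    have ih := self_add_le_pow h2 c
    have h1 : 1 ≤ lam ^ (c + 1) := Nat.one_le_pow _ _ (by omega)
    calc lam + (c + 1) = (lam + c) + 1 := by ring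
      _ ≤ lam ^ (c + 1) + lam ^ (c + 1) := add_le_add ih h1
      _ = 2 * lam ^ (c + 1) := by ring
      _ ≤ lam * lam ^ (c + 1) := Nat.mul_le_mul_right _ h2
      _ = lam ^ (c + 1 + 1) := by rw [← pow_succ']

/-- The numeric side conditions of the stages for `T₀ = log₂ s + 5`, `λ = log₂ s + 2` and the
weight bound `(3s+3)^(T₀+m³)` of the gate polynomials. [folklore] -/
theorem numeric_bounds (s : ℕ) {m : ℕ} (hm : 2 ≤ m) :
    m * (Nat.log 2 s + 5 + m ^ 3) ≤ (Nat.log 2 s + 2) ^ (m ^ 3 + m + 7) ∧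
    5 * ((3 * s + 3) ^ (Nat.log 2 s + 5 + m ^ 3)) ^ m ≤ 2 ^ (Nat.log 2 s + 2) ^ (m ^ 3 + m + 7) := by
  set L := Nat.log 2 s with hL
  have hs : s < 2 ^ (L + 1) := Nat.lt_pow_succ_log_self one_lt_two s
  set lam := L + 2 with hlam
  have h2 : 2 ≤ lam := by omega
  have hm' : m ≤ lam ^ m := (Nat.lt_two_pow_self).le.trans (Nat.pow_le_pow_left h2 m)
  have hN : L + 5 + m ^ 3 ≤ lam ^ (m ^ 3 + 4) :=
    calc L + 5 + m ^ 3 = lam + (m ^ 3 + 3) := by omega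
      _ ≤ _ := self_add_le_pow h2 _
  constructor
  · calc m * (L + 5 + m ^ 3) ≤ lam ^ m * lam ^ (m ^ 3 + 4) := Nat.mul_le_mul hm' hN
      _ = lam ^ (m ^ 3 + m + 4) := by rw [← pow_add]; congr 1; ring
      _ ≤ lam ^ (m ^ 3 + m + 7) := Nat.pow_le_pow_right (by omega) (by omega)
  · have h3s : 3 * s + 3 ≤ 2 ^ (lam + 1) := by
      have : 2 ^ (lam + 1) = 2 ^ (L + 1) * 4 := by rw [hlam]; ring
      omega
    have hexp : (lam + 1) * ((L + 5 + m ^ 3) * m) + 3 ≤ lam ^ (m ^ 3 + m + 7) := by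
      have h1 : lam + 1 ≤ lam ^ 2 := by nlinarith
      have hprod : (lam + 1) * ((L + 5 + m ^ 3) * m) ≤ lam ^ (m ^ 3 + m + 6) :=
        calc _ ≤ lam ^ 2 * (lam ^ (m ^ 3 + 4) * lam ^ m) := Nat.mul_le_mul h1 (Nat.mul_le_mul hN hm')
          _ = lam ^ (m ^ 3 + m + 6) := by rw [← pow_add, ← pow_add]; congr 1; ring
      have h3 : 3 ≤ lam ^ (m ^ 3 + m + 6) :=
        calc 3 ≤ lam ^ 2 := by nlinarith
          _ ≤ _ := Nat.pow_le_pow_right (by omega) (by omega)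
      calc _ ≤ lam ^ (m ^ 3 + m + 6) + lam ^ (m ^ 3 + m + 6) := add_le_add hprod h3
        _ = 2 * lam ^ (m ^ 3 + m + 6) := by ring
        _ ≤ lam * lam ^ (m ^ 3 + m + 6) := Nat.mul_le_mul_right _ h2
        _ = lam ^ (m ^ 3 + m + 6 + 1) := by rw [← pow_succ']
    calc 5 * ((3 * s + 3) ^ (L + 5 + m ^ 3)) ^ m ≤ 2 ^ 3 * ((2 ^ (lam + 1)) ^ (L + 5 + m ^ 3)) ^ m :=
          Nat.mul_le_mul (by norm_num) (Nat.pow_le_pow_left (Nat.pow_le_pow_left h3s _) _)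
      _ = 2 ^ ((lam + 1) * ((L + 5 + m ^ 3) * m) + 3) := by
          rw [← pow_mul, ← pow_mul, ← pow_add]; congr 1; ring
      _ ≤ 2 ^ lam ^ (m ^ 3 + m + 7) := Nat.pow_le_pow_right two_pos hexp

end BT

/-! ### The theorem -/

/-- **`ACC⁰ ⊆ SYM⁺`, quantitative form** (Beigel–Tarui 1994, Thm. 1.1; Williams 2014, Lemma 4.1,
existence half): discharge of the named fact `Williams2014_symPlus_of_acc`. The exponent is
`e = iterE (m³+m+7) ((m+1)d) 2 + 2`. [cite: BeigelTarui1994, Thm. 1.1] [cite: Williams2014, Lemma 4.1 and Appendix A] -/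
theorem Williams2014_symPlus_of_acc_holds : Williams2014_symPlus_of_acc := by
  intro d m hm
  refine ⟨BT.iterE (m ^ 3 + m + 7) ((m + 1) * d) 2 + 2, ?_⟩
  intro n s C hC hdepth hn hsize hfan
  have hslt : s < 2 ^ (Nat.log 2 s + 1) := Nat.lt_pow_succ_log_self one_lt_two s
  have hT₀ : 16 * s ≤ 2 ^ (Nat.log 2 s + 5) := by
    rw [show Nat.log 2 s + 5 = (Nat.log 2 s + 1) + 4 by ring, pow_add]; omega
  obtain ⟨ωs, hωs⟩ := BT.exists_seeds_majority (m := m) (T₀ := Nat.log 2 s + 5) C hsize hfan hT₀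
  let K : BT.Setup n := ⟨m, Nat.log 2 s + 5, C, BT.seedsOf ωs, hm, hC⟩
  have h2 : 2 ≤ Nat.log 2 s + 2 := by omega
  have hT : n + 1 + 1 ≤ 2 ^ (Nat.log 2 s + 2) := by
    rw [show Nat.log 2 s + 2 = (Nat.log 2 s + 1) + 1 by ring, pow_succ]; omega
  have hI : K.Inv (Nat.log 2 s + 2) ((m + 1) * d) 2 := K.inv_init h2 hT hdepth hωs
  obtain ⟨hDF, hWF⟩ := BT.numeric_bounds s hm
  have h0 := K.inv_zero_of_inv (lam := Nat.log 2 s + 2) (a := m ^ 3 + m + 7) h2 K.deg_FF_le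
    (K.wt_FF_le hfan (by show 1 ≤ Nat.log 2 s + 5; omega))
    (Nat.one_le_pow _ _ (by omega)) hDF hWF ((m + 1) * d) (by norm_num) hI
  exact K.symPlus_of_inv h2 h0

end Literature.Computability.Complexity
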